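/-
Copyright: harness tree, Literature layer (sorry-free). b2b-lace enum1-g51 (ENUMERATION SHARD A gen 51),
node KU-SEP, leaf KU-SEP-SEED, slice K1: semantics of the twisted SEEDCERT evaluator
(`SrwTwistSeedCertKernel`).  What-if / input-certification lane; nothing here is a value of a
lace-expansion quantity and no dimension is fixed.
-/
import Literature.Probability.FitznerVanDerHofstad2017.SrwTwistSeedCertKernel
import Literature.Probability.FitznerVanDerHofstad2017.SrwSeedCertSemantics
import Mathlib.RingTheory.PowerSeries.Basic
import Mathlib.RingTheory.PowerSeries.Exp
import Literature.Probability.FitznerVanDerHofstad2017.SrwTwistedCountEGF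
import HarnessLib

/-!
# Semantics of the twisted SEEDCERT evaluator (`SrwTwistSeedCertKernel`)

Exact meaning of the list arithmetic of the kernel, in five parts.
* Part 1 (packed products): `getD_pconv` — for `u`, `v` of length `≤ L` and `k < L`, coefficient `k`
  of `pconv L u v` is the Cauchy coefficient `Σ_{i ≤ k} u_i v_{k-i}`; Kronecker substitution at the
  base `2^b`, `b = log₂ (Σ u · max v) + 1`, is exact because every Cauchy coefficient is `< 2^b`
  (`cauchy_coeff_le`, `eval_natPoly_two_pow`, `coeff_natPoly_mul`, `sum_digits_div_mod`, `getD_unpackT`).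
* Part 2 (signed / Gaussian lists): `zval`, `zval_subPN`, `zval_mulPN`, `zval_gzMul_re/im`,
  `zval_gzMulW_re/im` — the `(pos, neg)` pairs and Gaussian pairs evaluate to the exact integer /
  Gaussian-integer Cauchy products.
* Part 3 (power table): the invariant `TwInv` (parity class + exact coefficients against the formal
  exponential generating function `twG m J Q = Σ_N twRowC N X^N/N!` of the twisted row) is preserved by
  `gzMul` and binary powering; `TwCert.twInv_table`: entry `N` of `gzTable` is `N!·[X^N] twG^D` split by
  the parity of `N` into real and imaginary parts.
* Part 4 (Horner sums): `TwCert.PqT_table_real`, `TwCert.UqT_table_real` — `P_n`, `U_n` of the kernel are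
  the exact truncated sums `Σ_{i<cnt n} C(2i+n',n') (2i)! Re[X^{2i}] twG^D /((2D)^{2i} qden^D) [· E_λ(2i+n'+1)]`.
* Part 5 (analytic side): `norm_coeff_twG_pow_le` — `N!·‖[X^N] twG^D‖ ≤ q^D (2D)^N` when `|Q_j| ≤ q`;
  `hasSum_coeff_twG_pow` — `Σ_N [X^N] twG^p · s^N = Φ(s)^p`, `Φ(s) = Σ_{j≤J} ε_j i^j Q_j I_{jm}(2s)`.
What-if / input-certification lane; `D` is a parameter throughout and no dimension is fixed.
[cite: FitznerVanDerHofstad2016NoBLE, §5.1.1 (5.4)–(5.5) pp. 1089–1090]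
-/


set_option Elab.async false

namespace Literature.Probability.FitznerVanDerHofstad2017.SeedCert

open Finset Polynomial
open scoped Nat

/-! ### List sums and maxima -/

/-- `lsumNAux l acc = acc + Σ l`. [cite: FitznerVanDerHofstad2016NoBLE, §5.1.1 (5.4)–(5.5) pp. 1089–1090] -/
theorem lsumNAux_eq : ∀ (l : List ℕ) (acc : ℕ), lsumNAux l acc = acc + l.sum
  | [], acc => by simp [lsumNAux]
  | x :: xs, acc => by rw [lsumNAux, lsumNAux_eq xs, List.sum_cons]; ring

/-- `lsumN l = Σ l`. [cite: FitznerVanDerHofstad2016NoBLE, §5.1.1 (5.4)–(5.5) pp. 1089–1090] -/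
theorem lsumN_eq (l : List ℕ) : lsumN l = l.sum := by simp [lsumN, lsumNAux_eq]

/-- The accumulator and every entry are `≤ maxNAux l m`. [cite: FitznerVanDerHofstad2016NoBLE, §5.1.1 (5.4)–(5.5) pp. 1089–1090] -/
theorem le_maxNAux : ∀ (l : List ℕ) (m : ℕ), m ≤ maxNAux l m ∧ ∀ i, l.getD i 0 ≤ maxNAux l m
  | [], m => ⟨le_rfl, fun i => by simp⟩
  | x :: xs, m => by
      have h := le_maxNAux xs (if m ≤ x then x else m)
      refine ⟨le_trans ?_ h.1, fun i => ?_⟩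
      · split_ifs <;> omega
      · cases i with
        | zero =>
            simp only [maxNAux, List.getD_cons_zero]
            refine le_trans ?_ h.1
            split_ifs <;> omega
        | succ i => simp only [maxNAux, List.getD_cons_succ]; exact h.2 i

/-- Every entry is `≤ maxN l` (entries beyond the length are `0`). [cite: FitznerVanDerHofstad2016NoBLE, §5.1.1 (5.4)–(5.5) pp. 1089–1090] -/
theorem getD_le_maxN (l : List ℕ) (i : ℕ) : l.getD i 0 ≤ maxN l := (le_maxNAux l 0).2 i

/-- Partial sums of the entries are `≤ Σ l`. [cite: FitznerVanDerHofstad2016NoBLE, §5.1.1 (5.4)–(5.5) pp. 1089–1090] -/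
theorem sum_range_getD_le_sum : ∀ (l : List ℕ) (n : ℕ), ∑ i ∈ range n, l.getD i 0 ≤ l.sum
  | [], n => by simp
  | x :: xs, 0 => by simp
  | x :: xs, n + 1 => by
      rw [sum_range_succ', List.sum_cons]
      simp only [List.getD_cons_succ, List.getD_cons_zero]
      have := sum_range_getD_le_sum xs n
      omega

/-! ### Packing -/

/-- `headD 0 = getD 0 0`. [cite: FitznerVanDerHofstad2016NoBLE, §5.1.1 (5.4)–(5.5) pp. 1089–1090] -/
theorem headD_eq_getD_zero : ∀ (l : List ℕ), l.headD 0 = l.getD 0 0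
  | [] => rfl
  | _ :: _ => rfl

/-- `packT b j l = Σ_{i<2^j} l_i 2^{b i}` for `l` of length `≤ 2^j`. [cite: FitznerVanDerHofstad2016NoBLE, §5.1.1 (5.4)–(5.5) pp. 1089–1090] -/
theorem packT_eq (b : ℕ) : ∀ (j : ℕ) (l : List ℕ), l.length ≤ 2 ^ j →
    packT b j l = ∑ i ∈ range (2 ^ j), l.getD i 0 * 2 ^ (b * i)
  | 0, l, _ => by rw [packT, headD_eq_getD_zero]; simp
  | j + 1, l, hl => by
      have h2 : 2 ^ (j + 1) = 2 ^ j + 2 ^ j := by rw [pow_succ]; ring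
      have ht : (l.take (2 ^ j)).length ≤ 2 ^ j := by simp
      have hd : (l.drop (2 ^ j)).length ≤ 2 ^ j := by simp; omega
      rw [packT, packT_eq b j _ ht, packT_eq b j _ hd, Nat.shiftLeft_eq, h2, sum_range_add]
      congr 1
      · refine sum_congr rfl fun i hi => ?_
        rw [List.getD_eq_getElem?_getD, List.getElem?_take, if_pos (mem_range.1 hi),
          ← List.getD_eq_getElem?_getD]
      · rw [sum_mul]
        refine sum_congr rfl fun i _ => ?_
        rw [List.getD_eq_getElem?_getD, List.getElem?_drop, ← List.getD_eq_getElem?_getD,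
          mul_add, pow_add]
        ring

/-- The fuel-bounded depth search succeeds: `L ≤ 2^{depthAux fuel j L}` when `L ≤ 2^{j+fuel}`. [cite: FitznerVanDerHofstad2016NoBLE, §5.1.1 (5.4)–(5.5) pp. 1089–1090] -/
theorem le_two_pow_depthAux : ∀ (fuel j L : ℕ), L ≤ 2 ^ (j + fuel) → L ≤ 2 ^ depthAux fuel j L
  | 0, j, L, h => by simpa [depthAux] using h
  | fuel + 1, j, L, h => by
      rw [depthAux]
      split_ifs with hL
      · exact hL
      · exact le_two_pow_depthAux fuel (j + 1) L (by rwa [show j + 1 + fuel = j + (fuel + 1) by ring])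

/-- `L ≤ 2^{depthOf L}`. [cite: FitznerVanDerHofstad2016NoBLE, §5.1.1 (5.4)–(5.5) pp. 1089–1090] -/
theorem le_two_pow_depthOf (L : ℕ) : L ≤ 2 ^ depthOf L :=
  le_two_pow_depthAux L 0 L (by rw [zero_add]; exact Nat.lt_two_pow_self.le)

/-! ### Unpacking (base-`2^b` digits) -/

/-- `unpackT b j N` has `2^j` entries. [cite: FitznerVanDerHofstad2016NoBLE, §5.1.1 (5.4)–(5.5) pp. 1089–1090] -/
theorem length_unpackT (b : ℕ) : ∀ (j N : ℕ), (unpackT b j N).length = 2 ^ j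
  | 0, N => rfl
  | j + 1, N => by
      rw [unpackT, List.length_append, length_unpackT b j, length_unpackT b j, pow_succ]; ring

/-- Digit `i < 2^j` of `unpackT b j N` is `⌊N / 2^{b i}⌋ mod 2^b` when `N < 2^{b 2^j}`. [cite: FitznerVanDerHofstad2016NoBLE, §5.1.1 (5.4)–(5.5) pp. 1089–1090] -/
theorem getD_unpackT (b : ℕ) : ∀ (j N i : ℕ), N < 2 ^ (b * 2 ^ j) → i < 2 ^ j →
    (unpackT b j N).getD i 0 = N / 2 ^ (b * i) % 2 ^ b
  | 0, N, i, hN, hi => by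
      have hi0 : i = 0 := by simpa using hi
      subst hi0
      simp only [unpackT, List.getD_cons_zero, mul_zero, pow_zero, Nat.div_one]
      exact (Nat.mod_eq_of_lt (by simpa using hN)).symm
  | j + 1, N, i, hN, hi => by
      rw [unpackT, Nat.and_two_pow_sub_one_eq_mod, Nat.shiftRight_eq_div_pow]
      by_cases hlt : i < 2 ^ j
      · rw [List.getD_eq_getElem?_getD, List.getElem?_append_left (by rw [length_unpackT]; exact hlt),
          ← List.getD_eq_getElem?_getD,
          getD_unpackT b j _ i (Nat.mod_lt _ (by positivity)) hlt]
        have hsplit : 2 ^ (b * 2 ^ j) = 2 ^ (b * i) * 2 ^ (b * (2 ^ j - i)) := by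
          rw [← pow_add, ← mul_add]; congr 2; omega
        rw [hsplit, Nat.mod_mul_right_div_self, Nat.mod_mod_of_dvd]
        exact Nat.pow_dvd_pow 2 (Nat.le_mul_of_pos_right b (by omega))
      · rw [not_lt] at hlt
        have hi' : i - 2 ^ j < 2 ^ j := by rw [pow_succ] at hi; omega
        have hN' : N / 2 ^ (b * 2 ^ j) < 2 ^ (b * 2 ^ j) := by
          rw [Nat.div_lt_iff_lt_mul (by positivity), ← pow_add, ← mul_add, ← mul_two, ← pow_succ]
          exact hN
        rw [List.getD_eq_getElem?_getD, List.getElem?_append_right (by rw [length_unpackT]; exact hlt),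
          length_unpackT, ← List.getD_eq_getElem?_getD, getD_unpackT b j _ _ hN' hi',
          Nat.div_div_eq_div_mul, ← pow_add, ← mul_add, show 2 ^ j + (i - 2 ^ j) = i by omega]

/-! ### Digit sums -/

/-- A digit sum with `D` digits `< B` is `< B^D`. [cite: FitznerVanDerHofstad2016NoBLE, §5.1.1 (5.4)–(5.5) pp. 1089–1090] -/
theorem sum_digits_lt (B : ℕ) (hB : 0 < B) (c : ℕ → ℕ) (hc : ∀ k, c k < B) :
    ∀ D, ∑ k ∈ range D, c k * B ^ k < B ^ D
  | 0 => by simp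
  | D + 1 => by
      rw [sum_range_succ, pow_succ]
      have h1 := sum_digits_lt B hB c hc D
      have h2 : (c D + 1) * B ^ D ≤ B * B ^ D := Nat.mul_le_mul_right _ (hc D)
      nlinarith

/-- Shifting out the lowest digit. [cite: FitznerVanDerHofstad2016NoBLE, §5.1.1 (5.4)–(5.5) pp. 1089–1090] -/
theorem sum_digits_succ (B : ℕ) (c : ℕ → ℕ) (D : ℕ) :
    ∑ k ∈ range (D + 1), c k * B ^ k = c 0 + B * ∑ k ∈ range D, c (k + 1) * B ^ k := by
  rw [sum_range_succ', pow_zero, mul_one, add_comm, mul_sum]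
  congr 1
  exact sum_congr rfl fun k _ => by rw [pow_succ]; ring

/-- Digit extraction: `⌊(Σ_{k<D} c_k B^k) / B^i⌋ mod B = c_i` (`0` beyond `D`) when all `c_k < B`.
[cite: FitznerVanDerHofstad2016NoBLE, §5.1.1 (5.4)–(5.5) pp. 1089–1090] -/
theorem sum_digits_div_mod (B : ℕ) (hB : 0 < B) : ∀ (i : ℕ) (c : ℕ → ℕ) (D : ℕ), (∀ k, c k < B) →
    (∑ k ∈ range D, c k * B ^ k) / B ^ i % B = if i < D then c i else 0
  | i, c, 0, _ => by simp
  | 0, c, D + 1, hc => by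
      rw [sum_digits_succ, pow_zero, Nat.div_one, Nat.add_mul_mod_self_left, Nat.mod_eq_of_lt (hc 0),
        if_pos (Nat.succ_pos _)]
  | i + 1, c, D + 1, hc => by
      rw [sum_digits_succ, pow_succ', ← Nat.div_div_eq_div_mul, Nat.add_mul_div_left _ _ hB,
        Nat.div_eq_of_lt (hc 0), zero_add, sum_digits_div_mod B hB i (fun k => c (k + 1)) D fun k => hc _]
      simp

/-- Truncation: `(Σ_{k<D} c_k B^k) mod B^L = Σ_{k<L} c_k B^k` for `L ≤ D` when all `c_k < B`. [cite: FitznerVanDerHofstad2016NoBLE, §5.1.1 (5.4)–(5.5) pp. 1089–1090] -/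
theorem sum_digits_mod_pow (B : ℕ) (hB : 0 < B) (c : ℕ → ℕ) (hc : ∀ k, c k < B) (D L : ℕ)
    (hLD : L ≤ D) : (∑ k ∈ range D, c k * B ^ k) % B ^ L = ∑ k ∈ range L, c k * B ^ k := by
  rw [← sum_range_add_sum_Ico _ hLD, sum_Ico_eq_sum_range]
  have : ∑ k ∈ range (D - L), c (L + k) * B ^ (L + k) = B ^ L * ∑ k ∈ range (D - L), c (L + k) * B ^ k := by
    rw [mul_sum]
    exact sum_congr rfl fun k _ => by rw [pow_add]; ring
  rw [this, Nat.add_mul_mod_self_left, Nat.mod_eq_of_lt (sum_digits_lt B hB c hc L)]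

/-! ### The coefficient polynomial of a list -/

/-- `natPoly l = Σ_i l_i X^i ∈ ℕ[X]`. [cite: FitznerVanDerHofstad2016NoBLE, §5.1.1 (5.4)–(5.5) pp. 1089–1090] -/
noncomputable def natPoly (l : List ℕ) : ℕ[X] := ∑ i ∈ range l.length, C (l.getD i 0) * X ^ i

/-- Coefficients of `natPoly l` are the entries (`0` beyond the length). [cite: FitznerVanDerHofstad2016NoBLE, §5.1.1 (5.4)–(5.5) pp. 1089–1090] -/
theorem coeff_natPoly (l : List ℕ) (n : ℕ) : (natPoly l).coeff n = l.getD n 0 := by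
  rw [natPoly, finsetSum_coeff]
  simp only [coeff_C_mul_X_pow]
  rw [sum_ite_eq]
  split_ifs with h
  · rfl
  · rw [List.getD_eq_default]
    simpa using h

/-- `natPoly l` has degree `< |l| + 1`. [cite: FitznerVanDerHofstad2016NoBLE, §5.1.1 (5.4)–(5.5) pp. 1089–1090] -/
theorem natDegree_natPoly_le (l : List ℕ) : (natPoly l).natDegree ≤ l.length := by
  rw [natDegree_le_iff_coeff_eq_zero]
  intro N hN
  rw [coeff_natPoly, List.getD_eq_default]
  exact_mod_cast hN.le

/-- `natPoly l` evaluated at `2^b` is the packed number. [cite: FitznerVanDerHofstad2016NoBLE, §5.1.1 (5.4)–(5.5) pp. 1089–1090] -/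
theorem eval_natPoly_two_pow (l : List ℕ) (b j : ℕ) (hl : l.length ≤ 2 ^ j) :
    (natPoly l).eval (2 ^ b) = packT b j l := by
  rw [packT_eq b j l hl, natPoly, eval_finsetSum, ← sum_range_add_sum_Ico _ hl, sum_Ico_eq_sum_range]
  simp only [eval_mul, eval_C, eval_pow, eval_X, ← pow_mul]
  have : ∑ k ∈ range (2 ^ j - l.length), l.getD (l.length + k) 0 * 2 ^ (b * (l.length + k)) = 0 :=
    sum_eq_zero fun k _ => by rw [List.getD_eq_default _ _ (by omega), zero_mul]
  rw [this, add_zero]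

/-- Coefficients of a product of coefficient polynomials are the Cauchy coefficients. [cite: FitznerVanDerHofstad2016NoBLE, §5.1.1 (5.4)–(5.5) pp. 1089–1090] -/
theorem coeff_natPoly_mul (u v : List ℕ) (k : ℕ) :
    (natPoly u * natPoly v).coeff k = ∑ i ∈ range (k + 1), u.getD i 0 * v.getD (k - i) 0 := by
  rw [coeff_mul, Nat.sum_antidiagonal_eq_sum_range_succ_mk]
  simp only [coeff_natPoly]

/-- Every Cauchy coefficient is `≤ Σ u · max v`. [cite: FitznerVanDerHofstad2016NoBLE, §5.1.1 (5.4)–(5.5) pp. 1089–1090] -/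
theorem cauchy_coeff_le (u v : List ℕ) (k : ℕ) :
    ∑ i ∈ range (k + 1), u.getD i 0 * v.getD (k - i) 0 ≤ u.sum * maxN v :=
  calc ∑ i ∈ range (k + 1), u.getD i 0 * v.getD (k - i) 0
        ≤ ∑ i ∈ range (k + 1), u.getD i 0 * maxN v :=
          sum_le_sum fun i _ => Nat.mul_le_mul_left _ (getD_le_maxN v _)
    _ = (∑ i ∈ range (k + 1), u.getD i 0) * maxN v := by rw [sum_mul]
    _ ≤ u.sum * maxN v := Nat.mul_le_mul_right _ (sum_range_getD_le_sum u _)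

/-! ### The packed truncated product -/

/-- **Kronecker substitution is exact**: with `L ≤ 2^j`, operands of length `≤ L` and a digit width
`b` with `Σ u · max v < 2^b`, entry `k < L` of the unpacked truncated product is the Cauchy coefficient.
[cite: FitznerVanDerHofstad2016NoBLE, §5.1.1 (5.4)–(5.5) pp. 1089–1090] -/
theorem getD_packedProduct (b j L : ℕ) (u v : List ℕ) (hL : L ≤ 2 ^ j) (hu : u.length ≤ L)
    (hv : v.length ≤ L) (hb : u.sum * maxN v < 2 ^ b) (k : ℕ) (hk : k < L) :
    ((unpackT b j ((packT b j u * packT b j v) &&& (2 ^ (b * L) - 1))).take L).getD k 0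
      = ∑ i ∈ range (k + 1), u.getD i 0 * v.getD (k - i) 0 := by
  have hB : 0 < 2 ^ b := by positivity
  set c : ℕ → ℕ := fun k => (natPoly u * natPoly v).coeff k with hc
  have hclt : ∀ k, c k < 2 ^ b := fun k =>
    lt_of_le_of_lt (by rw [hc]; dsimp only; rw [coeff_natPoly_mul]; exact cauchy_coeff_le u v k) hb
  set D := max ((natPoly u * natPoly v).natDegree + 1) L with hD
  have hLD : L ≤ D := le_max_right _ _
  have hprod : packT b j u * packT b j v = ∑ k ∈ range D, c k * (2 ^ b) ^ k := by
    rw [← eval_natPoly_two_pow u b j (hu.trans hL), ← eval_natPoly_two_pow v b j (hv.trans hL), ← eval_mul]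
    exact eval_eq_sum_range' (lt_of_lt_of_le (Nat.lt_succ_self _) (le_max_left _ _)) _
  have hlow : ∑ k ∈ range L, c k * (2 ^ b) ^ k < 2 ^ (b * 2 ^ j) :=
    calc ∑ k ∈ range L, c k * (2 ^ b) ^ k < (2 ^ b) ^ L := sum_digits_lt _ hB c hclt L
      _ ≤ (2 ^ b) ^ 2 ^ j := Nat.pow_le_pow_right hB hL
      _ = 2 ^ (b * 2 ^ j) := (pow_mul 2 b (2 ^ j)).symm
  rw [Nat.and_two_pow_sub_one_eq_mod, hprod, pow_mul, sum_digits_mod_pow (2 ^ b) hB c hclt D L hLD,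
    List.getD_eq_getElem?_getD, List.getElem?_take, if_pos hk, ← List.getD_eq_getElem?_getD,
    getD_unpackT b j _ k hlow (lt_of_lt_of_le hk hL), pow_mul, sum_digits_div_mod (2 ^ b) hB k c L hclt,
    if_pos hk, hc]
  exact coeff_natPoly_mul u v k

/-- `pconv L u v` has length `L`. [cite: FitznerVanDerHofstad2016NoBLE, §5.1.1 (5.4)–(5.5) pp. 1089–1090] -/
theorem length_pconv (L : ℕ) (u v : List ℕ) : (pconv L u v).length = L := by
  simp only [pconv, List.length_take, length_unpackT]
  exact min_eq_left (le_two_pow_depthOf L)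

/-- **Coefficient `k < L` of the packed truncated product is the Cauchy coefficient** (operands of
length `≤ L`). [cite: FitznerVanDerHofstad2016NoBLE, §5.1.1 (5.4)–(5.5) pp. 1089–1090] -/
theorem getD_pconv (L : ℕ) (u v : List ℕ) (hu : u.length ≤ L) (hv : v.length ≤ L) (k : ℕ)
    (hk : k < L) : (pconv L u v).getD k 0 = ∑ i ∈ range (k + 1), u.getD i 0 * v.getD (k - i) 0 :=
  getD_packedProduct _ _ L u v (le_two_pow_depthOf L) hu hv
    (by rw [← lsumN_eq]; exact Nat.lt_log2_self) k hk


/-! ## Part 2. Signed and Gaussian coefficient lists: exact integer semantics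

A signed list `P = (P⁺, P⁻)` has the integer value `zval P k = P⁺_k - P⁻_k` at entry `k`; the kernel
operations act on these values exactly (`mulPN` = truncated Cauchy product, `addPN`/`subPN`, `shiftPN` =
multiplication by `X^σ`, `normPN` = same values with disjoint parts, `divPN` = exact division when the
divisor divides the value and the parts are disjoint). -/

/-- The integer value of entry `k` of a signed list `(P⁺, P⁻)`. [cite: FitznerVanDerHofstad2016NoBLE, §5.1.1 (5.4)–(5.5) pp. 1089–1090] -/
def zval (P : List ℕ × List ℕ) (k : ℕ) : ℤ := (P.1.getD k 0 : ℤ) - (P.2.getD k 0 : ℤ)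

/-- `getD` below a `take`. [cite: FitznerVanDerHofstad2016NoBLE, §5.1.1 (5.4)–(5.5) pp. 1089–1090] -/
theorem getD_take_of_lt (l : List ℕ) {k L : ℕ} (hk : k < L) : (l.take L).getD k 0 = l.getD k 0 := by
  rw [List.getD_eq_getElem?_getD, List.getElem?_take, if_pos hk, ← List.getD_eq_getElem?_getD]

/-- `getD` of a zero list. [cite: FitznerVanDerHofstad2016NoBLE, §5.1.1 (5.4)–(5.5) pp. 1089–1090] -/
theorem getD_replicate_zero (n k : ℕ) : (List.replicate n 0 : List ℕ).getD k 0 = 0 := by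
  rw [List.getD_eq_getElem?_getD, List.getElem?_replicate]
  split_ifs <;> rfl

/-- `getD` of a list prefixed by `σ` zeros. [cite: FitznerVanDerHofstad2016NoBLE, §5.1.1 (5.4)–(5.5) pp. 1089–1090] -/
theorem getD_replicate_append (σ : ℕ) (l : List ℕ) (k : ℕ) :
    (List.replicate σ 0 ++ l).getD k 0 = if k < σ then 0 else l.getD (k - σ) 0 := by
  rw [List.getD_eq_getElem?_getD]
  split_ifs with h
  · rw [List.getElem?_append_left (by simpa using h), List.getElem?_replicate, if_pos h]
    rfl
  · rw [List.getElem?_append_right (by simpa using not_lt.1 h), List.length_replicate,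
      ← List.getD_eq_getElem?_getD]

/-- **`mulPN` is the truncated Cauchy product of the values.** [cite: FitznerVanDerHofstad2016NoBLE, §5.1.1 (5.4)–(5.5) pp. 1089–1090] -/
theorem zval_mulPN (P Q : List ℕ × List ℕ) (L : ℕ) (hp1 : P.1.length ≤ L) (hp2 : P.2.length ≤ L)
    (hq1 : Q.1.length ≤ L) (hq2 : Q.2.length ≤ L) (k : ℕ) (hk : k < L) :
    zval (mulPN P Q L) k = ∑ i ∈ range (k + 1), zval P i * zval Q (k - i) := by
  simp only [zval, mulPN, getD_zipAddN]
  rw [getD_pconv L _ _ hp1 hq1 k hk, getD_pconv L _ _ hp2 hq2 k hk, getD_pconv L _ _ hp1 hq2 k hk,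
    getD_pconv L _ _ hp2 hq1 k hk]
  push_cast
  rw [← sum_add_distrib, ← sum_add_distrib, ← sum_sub_distrib]
  exact sum_congr rfl fun i _ => by ring

/-- `mulPN P Q L` has both parts of length `L`. [cite: FitznerVanDerHofstad2016NoBLE, §5.1.1 (5.4)–(5.5) pp. 1089–1090] -/
theorem length_mulPN (P Q : List ℕ × List ℕ) (L : ℕ) :
    (mulPN P Q L).1.length = L ∧ (mulPN P Q L).2.length = L := by
  simp [mulPN, length_zipAddN, length_pconv]

/-- `addPN` adds values. [cite: FitznerVanDerHofstad2016NoBLE, §5.1.1 (5.4)–(5.5) pp. 1089–1090] -/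
theorem zval_addPN (P Q : List ℕ × List ℕ) (k : ℕ) : zval (addPN P Q) k = zval P k + zval Q k := by
  simp only [zval, addPN, getD_zipAddN]; push_cast; ring

/-- `subPN` subtracts values. [cite: FitznerVanDerHofstad2016NoBLE, §5.1.1 (5.4)–(5.5) pp. 1089–1090] -/
theorem zval_subPN (P Q : List ℕ × List ℕ) (k : ℕ) : zval (subPN P Q) k = zval P k - zval Q k := by
  simp only [zval, subPN, getD_zipAddN]; push_cast; ring

/-- Lengths of `addPN`. [cite: FitznerVanDerHofstad2016NoBLE, §5.1.1 (5.4)–(5.5) pp. 1089–1090] -/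
theorem length_addPN (P Q : List ℕ × List ℕ) :
    (addPN P Q).1.length = max P.1.length Q.1.length ∧
      (addPN P Q).2.length = max P.2.length Q.2.length := by
  simp [addPN, length_zipAddN]

/-- Lengths of `subPN`. [cite: FitznerVanDerHofstad2016NoBLE, §5.1.1 (5.4)–(5.5) pp. 1089–1090] -/
theorem length_subPN (P Q : List ℕ × List ℕ) :
    (subPN P Q).1.length = max P.1.length Q.2.length ∧
      (subPN P Q).2.length = max P.2.length Q.1.length := by
  simp [subPN, length_zipAddN]

/-- `shiftPN σ L` multiplies the values by `X^σ` (entries `< L`). [cite: FitznerVanDerHofstad2016NoBLE, §5.1.1 (5.4)–(5.5) pp. 1089–1090] -/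
theorem zval_shiftPN (σ L : ℕ) (P : List ℕ × List ℕ) (k : ℕ) (hk : k < L) :
    zval (shiftPN σ L P) k = if σ ≤ k then zval P (k - σ) else 0 := by
  simp only [zval, shiftPN, getD_take_of_lt _ hk, getD_replicate_append]
  by_cases h : σ ≤ k
  · rw [if_neg (not_lt.2 h), if_neg (not_lt.2 h), if_pos h]
  · rw [if_pos (lt_of_not_ge h), if_pos (lt_of_not_ge h), if_neg h]
    simp

/-- Lengths of `shiftPN`. [cite: FitznerVanDerHofstad2016NoBLE, §5.1.1 (5.4)–(5.5) pp. 1089–1090] -/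
theorem length_shiftPN (σ L : ℕ) (P : List ℕ × List ℕ) (h1 : L ≤ σ + P.1.length)
    (h2 : L ≤ σ + P.2.length) : (shiftPN σ L P).1.length = L ∧ (shiftPN σ L P).2.length = L := by
  simp only [shiftPN, List.length_take, List.length_append, List.length_replicate]
  omega

/-- `psubN` is the entrywise truncated difference. [cite: FitznerVanDerHofstad2016NoBLE, §5.1.1 (5.4)–(5.5) pp. 1089–1090] -/
theorem getD_psubN : ∀ (p n : List ℕ) (k : ℕ), (psubN p n).getD k 0 = p.getD k 0 - n.getD k 0
  | [], ns, k => by simp [psubN]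
  | p :: ps, [], k => by simp [psubN]
  | p :: ps, n :: ns, 0 => by simp [psubN]
  | p :: ps, n :: ns, k + 1 => by simp only [psubN, List.getD_cons_succ]; exact getD_psubN ps ns k

/-- Length of `psubN`. [cite: FitznerVanDerHofstad2016NoBLE, §5.1.1 (5.4)–(5.5) pp. 1089–1090] -/
theorem length_psubN : ∀ (p n : List ℕ), (psubN p n).length = max p.length n.length
  | [], ns => by simp [psubN]
  | p :: ps, [] => by simp [psubN]
  | p :: ps, n :: ns => by simp only [psubN, List.length_cons, length_psubN ps ns]; omega

/-- `normPN` keeps the values. [cite: FitznerVanDerHofstad2016NoBLE, §5.1.1 (5.4)–(5.5) pp. 1089–1090] -/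
theorem zval_normPN (P : List ℕ × List ℕ) (k : ℕ) : zval (normPN P) k = zval P k := by
  simp only [zval, normPN, getD_psubN]
  rcases le_total (P.1.getD k 0) (P.2.getD k 0) with h | h
  · rw [Nat.sub_eq_zero_of_le h, Nat.cast_sub h]; push_cast; ring
  · rw [Nat.sub_eq_zero_of_le h, Nat.cast_sub h]; push_cast; ring

/-- After `normPN` one of the two parts vanishes at every entry. [cite: FitznerVanDerHofstad2016NoBLE, §5.1.1 (5.4)–(5.5) pp. 1089–1090] -/
theorem normPN_disjoint (P : List ℕ × List ℕ) (k : ℕ) :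
    (normPN P).1.getD k 0 = 0 ∨ (normPN P).2.getD k 0 = 0 := by
  simp only [normPN, getD_psubN]
  rcases le_total (P.1.getD k 0) (P.2.getD k 0) with h | h
  · exact Or.inl (Nat.sub_eq_zero_of_le h)
  · exact Or.inr (Nat.sub_eq_zero_of_le h)

/-- Lengths of `normPN`. [cite: FitznerVanDerHofstad2016NoBLE, §5.1.1 (5.4)–(5.5) pp. 1089–1090] -/
theorem length_normPN (P : List ℕ × List ℕ) :
    (normPN P).1.length = max P.1.length P.2.length ∧
      (normPN P).2.length = max P.1.length P.2.length := by
  simp only [normPN, length_psubN]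
  exact ⟨trivial, max_comm _ _⟩

/-- **Exact division**: if the parts are disjoint at `k` and `Mf` divides the value, `divPN Mf` divides the
value exactly. [cite: FitznerVanDerHofstad2016NoBLE, §5.1.1 (5.4)–(5.5) pp. 1089–1090] -/
theorem zval_divPN_of_dvd (Mf : ℕ) (P : List ℕ × List ℕ) (k : ℕ)
    (hdisj : P.1.getD k 0 = 0 ∨ P.2.getD k 0 = 0) (hdvd : (Mf : ℤ) ∣ zval P k) :
    zval (divPN Mf P) k = zval P k / Mf := by
  simp only [zval, divPN, getD_divRow] at *
  rcases hdisj with h | h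
  · rw [h] at hdvd ⊢
    simp only [Nat.zero_div, Nat.cast_zero, zero_sub] at hdvd ⊢
    rw [Int.natCast_ediv, Int.neg_ediv_of_dvd (Int.dvd_neg.1 hdvd)]
  · rw [h] at hdvd ⊢
    simp only [Nat.zero_div, Nat.cast_zero, sub_zero] at hdvd ⊢
    rw [Int.natCast_ediv]

/-- Lengths of `divPN`. [cite: FitznerVanDerHofstad2016NoBLE, §5.1.1 (5.4)–(5.5) pp. 1089–1090] -/
theorem length_divPN (Mf : ℕ) (P : List ℕ × List ℕ) :
    (divPN Mf P).1.length = P.1.length ∧ (divPN Mf P).2.length = P.2.length := by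
  simp [divPN, length_divRow]

/-! ### The Gaussian products at the level of integer values -/

/-- All four parts of a Gaussian list have length `L`. [cite: FitznerVanDerHofstad2016NoBLE, §5.1.1 (5.4)–(5.5) pp. 1089–1090] -/
def GZlen (X : GZ) (L : ℕ) : Prop :=
  X.1.1.length = L ∧ X.1.2.length = L ∧ X.2.1.length = L ∧ X.2.2.length = L

/-- The undivided real product coefficient of `gzMul σ`: `Σ_{i≤k} a_i c_{k-i} - [σ ≤ k] Σ_{i ≤ k-σ} b_i d_{k-σ-i}`.
[cite: FitznerVanDerHofstad2016NoBLE, §5.1.1 (5.4)–(5.5) pp. 1089–1090] -/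
def prodRe (σ : ℕ) (X Y : GZ) (k : ℕ) : ℤ :=
  ∑ i ∈ range (k + 1), zval X.1 i * zval Y.1 (k - i)
    - (if σ ≤ k then ∑ i ∈ range (k - σ + 1), zval X.2 i * zval Y.2 (k - σ - i) else 0)

/-- The undivided imaginary product coefficient: `Σ_{i≤k} (a_i d_{k-i} + b_i c_{k-i})`.
[cite: FitznerVanDerHofstad2016NoBLE, §5.1.1 (5.4)–(5.5) pp. 1089–1090] -/
def prodIm (X Y : GZ) (k : ℕ) : ℤ :=
  ∑ i ∈ range (k + 1), zval X.1 i * zval Y.2 (k - i) + ∑ i ∈ range (k + 1), zval X.2 i * zval Y.1 (k - i)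

/-- `gzMul σ Mf L` returns lists of length `L`. [cite: FitznerVanDerHofstad2016NoBLE, §5.1.1 (5.4)–(5.5) pp. 1089–1090] -/
theorem gzMul_len (σ Mf L : ℕ) (X Y : GZ) : GZlen (gzMul σ Mf L X Y) L := by
  have hm := fun (P Q : List ℕ × List ℕ) => length_mulPN P Q L
  have hs := length_shiftPN σ L (mulPN X.2 Y.2 L) (by rw [(hm _ _).1]; omega) (by rw [(hm _ _).2]; omega)
  refine ⟨?_, ?_, ?_, ?_⟩ <;>
    simp only [gzMul, forcePN_eq, (length_divPN _ _).1, (length_divPN _ _).2, (length_normPN _).1,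
      (length_normPN _).2, (length_subPN _ _).1, (length_subPN _ _).2, (length_addPN _ _).1,
      (length_addPN _ _).2, (hm _ _).1, (hm _ _).2, hs.1, hs.2, max_self]

/-- **Real part of `gzMul`**: the exact quotient `prodRe / Mf` when `Mf ∣ prodRe`.
[cite: FitznerVanDerHofstad2016NoBLE, §5.1.1 (5.4)–(5.5) pp. 1089–1090] -/
theorem zval_gzMul_re (σ Mf L : ℕ) (X Y : GZ) (hX : GZlen X L) (hY : GZlen Y L) (k : ℕ) (hk : k < L)
    (hdvd : (Mf : ℤ) ∣ prodRe σ X Y k) : zval (gzMul σ Mf L X Y).1 k = prodRe σ X Y k / Mf := by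
  obtain ⟨hx1, hx2, hx3, hx4⟩ := hX
  obtain ⟨hy1, hy2, hy3, hy4⟩ := hY
  have hre : zval (normPN (subPN (mulPN X.1 Y.1 L) (shiftPN σ L (mulPN X.2 Y.2 L)))) k
      = prodRe σ X Y k := by
    rw [zval_normPN, zval_subPN, zval_mulPN _ _ L hx1.le hx2.le hy1.le hy2.le k hk,
      zval_shiftPN σ L _ k hk, prodRe]
    split_ifs with h
    · rw [zval_mulPN _ _ L hx3.le hx4.le hy3.le hy4.le (k - σ) (by omega)]
    · rfl
  simp only [gzMul, forcePN_eq]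
  rw [zval_divPN_of_dvd Mf _ k (normPN_disjoint _ _) (hre ▸ hdvd), hre]

/-- **Imaginary part of `gzMul`**: the exact quotient `prodIm / Mf` when `Mf ∣ prodIm`.
[cite: FitznerVanDerHofstad2016NoBLE, §5.1.1 (5.4)–(5.5) pp. 1089–1090] -/
theorem zval_gzMul_im (σ Mf L : ℕ) (X Y : GZ) (hX : GZlen X L) (hY : GZlen Y L) (k : ℕ) (hk : k < L)
    (hdvd : (Mf : ℤ) ∣ prodIm X Y k) : zval (gzMul σ Mf L X Y).2 k = prodIm X Y k / Mf := by
  obtain ⟨hx1, hx2, hx3, hx4⟩ := hX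
  obtain ⟨hy1, hy2, hy3, hy4⟩ := hY
  have him : zval (normPN (addPN (mulPN X.1 Y.2 L) (mulPN X.2 Y.1 L))) k = prodIm X Y k := by
    rw [zval_normPN, zval_addPN, zval_mulPN _ _ L hx1.le hx2.le hy3.le hy4.le k hk,
      zval_mulPN _ _ L hx3.le hx4.le hy1.le hy2.le k hk, prodIm]
  simp only [gzMul, forcePN_eq]
  rw [zval_divPN_of_dvd Mf _ k (normPN_disjoint _ _) (him ▸ hdvd), him]

/-- The undivided, unshifted real product coefficient of `gzMulW`: `Σ_{i≤k} (a_i c_{k-i} - b_i d_{k-i})`.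
[cite: FitznerVanDerHofstad2016NoBLE, §5.1.1 (5.4)–(5.5) pp. 1089–1090] -/
def prodReW (X Y : GZ) (k : ℕ) : ℤ :=
  ∑ i ∈ range (k + 1), zval X.1 i * zval Y.1 (k - i) - ∑ i ∈ range (k + 1), zval X.2 i * zval Y.2 (k - i)

/-- `gzMulW L` returns lists of length `L`. [cite: FitznerVanDerHofstad2016NoBLE, §5.1.1 (5.4)–(5.5) pp. 1089–1090] -/
theorem gzMulW_len (L : ℕ) (X Y : GZ) : GZlen (gzMulW L X Y) L := by
  have hm := fun (P Q : List ℕ × List ℕ) => length_mulPN P Q L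
  refine ⟨?_, ?_, ?_, ?_⟩ <;>
    simp only [gzMulW, forcePN_eq, (length_normPN _).1, (length_normPN _).2, (length_subPN _ _).1,
      (length_subPN _ _).2, (length_addPN _ _).1, (length_addPN _ _).2, (hm _ _).1, (hm _ _).2, max_self]

/-- **Real part of `gzMulW`** (operands of lengths `≤ L`, entries `< L`).
[cite: FitznerVanDerHofstad2016NoBLE, §5.1.1 (5.4)–(5.5) pp. 1089–1090] -/
theorem zval_gzMulW_re (L : ℕ) (X Y : GZ) (hx1 : X.1.1.length ≤ L) (hx2 : X.1.2.length ≤ L)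
    (hx3 : X.2.1.length ≤ L) (hx4 : X.2.2.length ≤ L) (hy1 : Y.1.1.length ≤ L)
    (hy2 : Y.1.2.length ≤ L) (hy3 : Y.2.1.length ≤ L) (hy4 : Y.2.2.length ≤ L) (k : ℕ) (hk : k < L) :
    zval (gzMulW L X Y).1 k = prodReW X Y k := by
  simp only [gzMulW, forcePN_eq]
  rw [zval_normPN, zval_subPN, zval_mulPN _ _ L hx1 hx2 hy1 hy2 k hk,
    zval_mulPN _ _ L hx3 hx4 hy3 hy4 k hk, prodReW]

/-- **Imaginary part of `gzMulW`** (operands of lengths `≤ L`, entries `< L`).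
[cite: FitznerVanDerHofstad2016NoBLE, §5.1.1 (5.4)–(5.5) pp. 1089–1090] -/
theorem zval_gzMulW_im (L : ℕ) (X Y : GZ) (hx1 : X.1.1.length ≤ L) (hx2 : X.1.2.length ≤ L)
    (hx3 : X.2.1.length ≤ L) (hx4 : X.2.2.length ≤ L) (hy1 : Y.1.1.length ≤ L)
    (hy2 : Y.1.2.length ≤ L) (hy3 : Y.2.1.length ≤ L) (hy4 : Y.2.2.length ≤ L) (k : ℕ) (hk : k < L) :
    zval (gzMulW L X Y).2 k = prodIm X Y k := by
  simp only [gzMulW, forcePN_eq]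
  rw [zval_normPN, zval_addPN, zval_mulPN _ _ L hx1 hx2 hy3 hy4 k hk,
    zval_mulPN _ _ L hx3 hx4 hy1 hy2 k hk, prodIm]


/-! ## Part 3. The power table: exact semantics against a formal EGF

The table rows are certified against the coefficients of the powers `G^p` of a formal power series
`G ∈ ℂ⟦s⟧` whose coefficients have the parity structure of the twisted EGF row (`ParityC σ`: real parts
on even exponents, imaginary parts on exponents `≡ σ (mod 2)`) and Gaussian-integer numerators
(`IntC`: `N! · [s^N] G ∈ ℤ[i]`).  The invariant `TwInv`: real entry `k` of the table is
`M̂! · Re [s^{2k}] G^p`, imaginary entry `k` is `M̂! · Im [s^{2k+σ}] G^p` (`k ≤ K`, `M̂ = 2K+1`); it is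
preserved by `gzMul` (parity-split Cauchy product; the division by `M̂!` is exact by integrality). -/

/-- **Parity-supported antidiagonal sums**: if `f` lives on `a ≡ α (mod 2)` (`α, β ∈ {0,1}`), then
`Σ_{a+b = 2k+α+β} f(a) g(b) = Σ_{i ≤ k} f(2i+α) g(2(k-i)+β)`. [cite: FitznerVanDerHofstad2016NoBLE, §5.1.1 (5.4)–(5.5) pp. 1089–1090] -/
theorem sum_antidiagonal_parity (f g : ℕ → ℝ) {α β : ℕ} (_hα : α < 2) (hβ : β < 2)
    (hf : ∀ a, a % 2 ≠ α → f a = 0) (k : ℕ) :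
    ∑ x ∈ antidiagonal (2 * k + α + β), f x.1 * g x.2
      = ∑ i ∈ range (k + 1), f (2 * i + α) * g (2 * (k - i) + β) := by
  rw [Nat.sum_antidiagonal_eq_sum_range_succ_mk]
  have hsub : (range (k + 1)).image (fun i => 2 * i + α) ⊆ range (2 * k + α + β).succ := by
    intro a ha
    rw [mem_image] at ha
    obtain ⟨i, hi, rfl⟩ := ha
    rw [mem_range] at hi ⊢
    omega
  have hz : ∀ a ∈ range (2 * k + α + β).succ, a ∉ (range (k + 1)).image (fun i => 2 * i + α) →
      f a * g (2 * k + α + β - a) = 0 := by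
    intro a ha hna
    by_cases hpar : a % 2 = α
    · exfalso
      refine hna (mem_image.2 ⟨a / 2, mem_range.2 ?_, ?_⟩)
      · rw [mem_range] at ha; omega
      · omega
    · rw [hf a hpar, zero_mul]
  rw [← sum_subset hsub hz, sum_image (fun i _ j _ h => by omega)]
  refine sum_congr rfl fun i hi => ?_
  rw [mem_range] at hi
  rw [show 2 * k + α + β - (2 * i + α) = 2 * (k - i) + β by omega]

/-- Parity structure of a formal series: real parts on even exponents, imaginary parts on exponents
`≡ σ (mod 2)`. [cite: FitznerVanDerHofstad2016NoBLE, §5.1.1 (5.4)–(5.5) pp. 1089–1090] -/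
def ParityC (σ : ℕ) (G : PowerSeries ℂ) : Prop :=
  (∀ N, N % 2 ≠ 0 → (PowerSeries.coeff N G).re = 0) ∧ (∀ N, N % 2 ≠ σ → (PowerSeries.coeff N G).im = 0)

/-- `1` has the parity structure. [cite: FitznerVanDerHofstad2016NoBLE, §5.1.1 (5.4)–(5.5) pp. 1089–1090] -/
theorem parityC_one (σ : ℕ) : ParityC σ (1 : PowerSeries ℂ) := by
  constructor
  · intro N hN
    rw [PowerSeries.coeff_one]
    split_ifs with h
    · omega
    · simp
  · intro N hN
    rw [PowerSeries.coeff_one]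
    split_ifs <;> simp

/-- The parity structure is closed under products (`σ ∈ {0,1}`). [cite: FitznerVanDerHofstad2016NoBLE, §5.1.1 (5.4)–(5.5) pp. 1089–1090] -/
theorem parityC_mul {σ : ℕ} (hσ : σ < 2) {G H : PowerSeries ℂ} (hG : ParityC σ G) (hH : ParityC σ H) :
    ParityC σ (G * H) := by
  constructor
  · intro N hN
    rw [PowerSeries.coeff_mul, Complex.re_sum]
    refine sum_eq_zero fun x hx => ?_
    rw [mem_antidiagonal] at hx
    rw [Complex.mul_re]
    have h1 : (PowerSeries.coeff x.1 G).re * (PowerSeries.coeff x.2 H).re = 0 := by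
      by_cases h : x.1 % 2 = 0
      · rw [hH.1 x.2 (by omega), mul_zero]
      · rw [hG.1 x.1 h, zero_mul]
    have h2 : (PowerSeries.coeff x.1 G).im * (PowerSeries.coeff x.2 H).im = 0 := by
      by_cases h : x.1 % 2 = σ
      · rw [hH.2 x.2 (by omega), mul_zero]
      · rw [hG.2 x.1 h, zero_mul]
    rw [h1, h2, sub_zero]
  · intro N hN
    rw [PowerSeries.coeff_mul, Complex.im_sum]
    refine sum_eq_zero fun x hx => ?_
    rw [mem_antidiagonal] at hx
    rw [Complex.mul_im]
    have h1 : (PowerSeries.coeff x.1 G).re * (PowerSeries.coeff x.2 H).im = 0 := by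
      by_cases h : x.1 % 2 = 0
      · rw [hH.2 x.2 (by omega), mul_zero]
      · rw [hG.1 x.1 h, zero_mul]
    have h2 : (PowerSeries.coeff x.1 G).im * (PowerSeries.coeff x.2 H).re = 0 := by
      by_cases h : x.1 % 2 = σ
      · rw [hH.1 x.2 (by omega), mul_zero]
      · rw [hG.2 x.1 h, zero_mul]
    rw [h1, h2, add_zero]

/-- The parity structure of the powers. [cite: FitznerVanDerHofstad2016NoBLE, §5.1.1 (5.4)–(5.5) pp. 1089–1090] -/
theorem parityC_pow {σ : ℕ} (hσ : σ < 2) {G : PowerSeries ℂ} (hG : ParityC σ G) :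
    ∀ p : ℕ, ParityC σ (G ^ p)
  | 0 => by rw [pow_zero]; exact parityC_one σ
  | p + 1 => by rw [pow_succ]; exact parityC_mul hσ (parityC_pow hσ hG p) hG

/-- Gaussian-integer numerators: `N! · [s^N] G ∈ ℤ[i]` for every `N`. [cite: FitznerVanDerHofstad2016NoBLE, §5.1.1 (5.4)–(5.5) pp. 1089–1090] -/
def IntC (G : PowerSeries ℂ) : Prop :=
  ∀ N, ∃ a b : ℤ, (N ! : ℂ) * PowerSeries.coeff N G = (a : ℂ) + (b : ℂ) * Complex.I

/-- `1` has Gaussian-integer numerators. [cite: FitznerVanDerHofstad2016NoBLE, §5.1.1 (5.4)–(5.5) pp. 1089–1090] -/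
theorem intC_one : IntC (1 : PowerSeries ℂ) := by
  intro N
  rw [PowerSeries.coeff_one]
  split_ifs with h
  · exact ⟨1, 0, by subst h; simp⟩
  · exact ⟨0, 0, by simp⟩

/-- Gaussian-integer numerators are closed under products (`N! = C(N,b) a! b!` on the antidiagonal).
[cite: FitznerVanDerHofstad2016NoBLE, §5.1.1 (5.4)–(5.5) pp. 1089–1090] -/
theorem intC_mul {G H : PowerSeries ℂ} (hG : IntC G) (hH : IntC H) : IntC (G * H) := by
  intro N
  rw [PowerSeries.coeff_mul, mul_sum]
  refine Finset.sum_induction _ (fun z : ℂ => ∃ a b : ℤ, z = (a : ℂ) + (b : ℂ) * Complex.I)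
    (fun z w ⟨a, b, hz⟩ ⟨a', b', hw⟩ => ⟨a + a', b + b', by rw [hz, hw]; push_cast; ring⟩)
    ⟨0, 0, by simp⟩ (fun x hx => ?_)
  rw [mem_antidiagonal] at hx
  obtain ⟨a1, b1, h1⟩ := hG x.1
  obtain ⟨a2, b2, h2⟩ := hH x.2
  have hfac : (N ! : ℂ) = (N.choose x.2 : ℂ) * (x.1 ! : ℂ) * (x.2 ! : ℂ) := by
    rw [← hx]
    exact_mod_cast (Nat.add_choose_mul_factorial_mul_factorial x.1 x.2).symm
  refine ⟨N.choose x.2 * (a1 * a2 - b1 * b2), N.choose x.2 * (a1 * b2 + b1 * a2), ?_⟩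
  calc (N ! : ℂ) * (PowerSeries.coeff x.1 G * PowerSeries.coeff x.2 H)
      = (N.choose x.2 : ℂ) * (((x.1 ! : ℂ)) * PowerSeries.coeff x.1 G)
          * (((x.2 ! : ℂ)) * PowerSeries.coeff x.2 H) := by rw [hfac]; ring
    _ = (N.choose x.2 : ℂ) * (((a1 : ℂ) + (b1 : ℂ) * Complex.I) * ((a2 : ℂ) + (b2 : ℂ) * Complex.I)) := by
          rw [h1, h2]; ring
    _ = _ := by
          have hI : Complex.I * Complex.I = -1 := Complex.I_mul_I
          push_cast
          linear_combination ((N.choose x.2 : ℂ) * (b1 : ℂ) * (b2 : ℂ)) * hI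

/-- Gaussian-integer numerators of the powers. [cite: FitznerVanDerHofstad2016NoBLE, §5.1.1 (5.4)–(5.5) pp. 1089–1090] -/
theorem intC_pow {G : PowerSeries ℂ} (hG : IntC G) : ∀ p : ℕ, IntC (G ^ p)
  | 0 => by rw [pow_zero]; exact intC_one
  | p + 1 => by rw [pow_succ]; exact intC_mul (intC_pow hG p) hG

/-- From Gaussian-integer numerators: `M̂! · Re [s^N] G ∈ ℤ` for `N ≤ M̂`. [cite: FitznerVanDerHofstad2016NoBLE, §5.1.1 (5.4)–(5.5) pp. 1089–1090] -/
theorem intC_re {G : PowerSeries ℂ} (hG : IntC G) {N Mh : ℕ} (hN : N ≤ Mh) :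
    ∃ z : ℤ, (Mh ! : ℝ) * (PowerSeries.coeff N G).re = z := by
  obtain ⟨a, b, hab⟩ := hG N
  have hre : (N ! : ℝ) * (PowerSeries.coeff N G).re = a := by
    have := congrArg Complex.re hab
    simpa [Complex.mul_re] using this
  refine ⟨(Mh ! / N ! : ℕ) * a, ?_⟩
  have hMh : (Mh ! : ℝ) = ((Mh ! / N ! : ℕ) : ℝ) * (N ! : ℝ) := by
    exact_mod_cast (Nat.div_mul_cancel (Nat.factorial_dvd_factorial hN)).symm
  rw [hMh, mul_assoc, hre, Int.cast_mul, Int.cast_natCast]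

/-- From Gaussian-integer numerators: `M̂! · Im [s^N] G ∈ ℤ` for `N ≤ M̂`. [cite: FitznerVanDerHofstad2016NoBLE, §5.1.1 (5.4)–(5.5) pp. 1089–1090] -/
theorem intC_im {G : PowerSeries ℂ} (hG : IntC G) {N Mh : ℕ} (hN : N ≤ Mh) :
    ∃ z : ℤ, (Mh ! : ℝ) * (PowerSeries.coeff N G).im = z := by
  obtain ⟨a, b, hab⟩ := hG N
  have him : (N ! : ℝ) * (PowerSeries.coeff N G).im = b := by
    have := congrArg Complex.im hab
    simpa [Complex.mul_im] using this
  refine ⟨(Mh ! / N ! : ℕ) * b, ?_⟩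
  have hMh : (Mh ! : ℝ) = ((Mh ! / N ! : ℕ) : ℝ) * (N ! : ℝ) := by
    exact_mod_cast (Nat.div_mul_cancel (Nat.factorial_dvd_factorial hN)).symm
  rw [hMh, mul_assoc, him, Int.cast_mul, Int.cast_natCast]

/-- **The table invariant** at power `p`: lengths `K+1`; real entry `k ≤ K` is `M̂! · Re [s^{2k}] G^p`,
imaginary entry `k ≤ K` is `M̂! · Im [s^{2k+σ}] G^p`. [cite: FitznerVanDerHofstad2016NoBLE, §5.1.1 (5.4)–(5.5) pp. 1089–1090] -/
structure TwInv (Mh K σ : ℕ) (G : PowerSeries ℂ) (p : ℕ) (X : GZ) : Prop where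
  len : GZlen X (K + 1)
  re : ∀ k, k ≤ K → (zval X.1 k : ℝ) = (Mh ! : ℝ) * (PowerSeries.coeff (2 * k) (G ^ p)).re
  im : ∀ k, k ≤ K → (zval X.2 k : ℝ) = (Mh ! : ℝ) * (PowerSeries.coeff (2 * k + σ) (G ^ p)).im

/-- An integer that is `M̂! · z` as a real is divisible, with quotient `z`. [cite: FitznerVanDerHofstad2016NoBLE, §5.1.1 (5.4)–(5.5) pp. 1089–1090] -/
theorem int_quot_of_real_eq {V : ℤ} {Mf : ℕ} (hMf : Mf ≠ 0) {z : ℤ} (h : (V : ℝ) = (Mf : ℝ) * (z : ℝ)) :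
    (Mf : ℤ) ∣ V ∧ V / (Mf : ℤ) = z := by
  have hV : V = (Mf : ℤ) * z := by exact_mod_cast h
  refine ⟨hV ▸ dvd_mul_right _ _, ?_⟩
  rw [hV, Int.mul_ediv_cancel_left z (by exact_mod_cast hMf)]

/-- **`gzMul` preserves the table invariant**: `Θ_p · Θ_{p'} / M̂! = Θ_{p+p'}`.
[cite: FitznerVanDerHofstad2016NoBLE, §5.1.1 (5.4)–(5.5) pp. 1089–1090] -/
theorem twInv_gzMul {Mh K σ : ℕ} {G : PowerSeries ℂ} (hσ : σ < 2) (hMh : Mh = 2 * K + 1)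
    (hpar : ParityC σ G) (hint : IntC G) {p p' : ℕ} {X Y : GZ} (hX : TwInv Mh K σ G p X)
    (hY : TwInv Mh K σ G p' Y) : TwInv Mh K σ G (p + p') (gzMul σ (Mh !) (K + 1) X Y) := by
  have hP := parityC_pow hσ hpar p
  have hP' := parityC_pow hσ hpar p'
  have hI := intC_pow hint (p + p')
  have hMf : Mh ! ≠ 0 := (Nat.factorial_pos _).ne'
  refine ⟨gzMul_len _ _ _ X Y, fun k hk => ?_, fun k hk => ?_⟩
  · -- the real identity
    have hRR : ∑ x ∈ antidiagonal (2 * k), (PowerSeries.coeff x.1 (G ^ p)).re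
        * (PowerSeries.coeff x.2 (G ^ p')).re
        = ∑ i ∈ range (k + 1), (PowerSeries.coeff (2 * i) (G ^ p)).re
          * (PowerSeries.coeff (2 * (k - i)) (G ^ p')).re := by
      have := sum_antidiagonal_parity (fun a => (PowerSeries.coeff a (G ^ p)).re)
        (fun b => (PowerSeries.coeff b (G ^ p')).re) (α := 0) (β := 0) (by norm_num) (by norm_num)
        (fun a ha => hP.1 a ha) k
      simpa only [add_zero] using this
    have hII : ∑ x ∈ antidiagonal (2 * k), (PowerSeries.coeff x.1 (G ^ p)).im
        * (PowerSeries.coeff x.2 (G ^ p')).im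
        = if σ ≤ k then ∑ i ∈ range (k - σ + 1), (PowerSeries.coeff (2 * i + σ) (G ^ p)).im
          * (PowerSeries.coeff (2 * (k - σ - i) + σ) (G ^ p')).im else 0 := by
      split_ifs with hσk
      · have := sum_antidiagonal_parity (fun a => (PowerSeries.coeff a (G ^ p)).im)
          (fun b => (PowerSeries.coeff b (G ^ p')).im) (α := σ) (β := σ) hσ hσ
          (fun a ha => hP.2 a ha) (k - σ)
        rw [show 2 * (k - σ) + σ + σ = 2 * k by omega] at this
        exact this
      · have hk0 : k = 0 := by omega
        have hσ1 : σ = 1 := by omega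
        subst hk0
        rw [mul_zero, Nat.antidiagonal_zero, sum_singleton]
        dsimp only
        rw [hP.2 0 (by omega), zero_mul]
    have hre : (prodRe σ X Y k : ℝ) = (Mh ! : ℝ) * ((Mh ! : ℝ)
        * (PowerSeries.coeff (2 * k) (G ^ (p + p'))).re) := by
      rw [pow_add, PowerSeries.coeff_mul, Complex.re_sum]
      simp only [Complex.mul_re]
      rw [sum_sub_distrib, hRR, hII, prodRe]
      push_cast
      have h1 : ∑ i ∈ range (k + 1), (zval X.1 i : ℝ) * (zval Y.1 (k - i) : ℝ)
          = (Mh ! : ℝ) * (Mh ! : ℝ) * ∑ i ∈ range (k + 1),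
            (PowerSeries.coeff (2 * i) (G ^ p)).re * (PowerSeries.coeff (2 * (k - i)) (G ^ p')).re := by
        rw [mul_sum]
        refine sum_congr rfl fun i hi => ?_
        rw [mem_range] at hi
        rw [hX.re i (by omega), hY.re (k - i) (by omega)]
        ring
      rw [h1]
      split_ifs with hσk
      · have h2 : ∑ i ∈ range (k - σ + 1), (zval X.2 i : ℝ) * (zval Y.2 (k - σ - i) : ℝ)
            = (Mh ! : ℝ) * (Mh ! : ℝ) * ∑ i ∈ range (k - σ + 1),
              (PowerSeries.coeff (2 * i + σ) (G ^ p)).im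
                * (PowerSeries.coeff (2 * (k - σ - i) + σ) (G ^ p')).im := by
          rw [mul_sum]
          refine sum_congr rfl fun i hi => ?_
          rw [mem_range] at hi
          rw [hX.im i (by omega), hY.im (k - σ - i) (by omega)]
          ring
        rw [h2]
        ring
      · ring
    obtain ⟨z, hz⟩ := intC_re hI (show 2 * k ≤ Mh by omega)
    rw [hz] at hre
    obtain ⟨hdvd, hq⟩ := int_quot_of_real_eq hMf hre
    rw [zval_gzMul_re σ (Mh !) (K + 1) X Y hX.len hY.len k (by omega) hdvd, hq, hz]
  · -- the imaginary identity
    have hRI : ∑ x ∈ antidiagonal (2 * k + σ), (PowerSeries.coeff x.1 (G ^ p)).re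
        * (PowerSeries.coeff x.2 (G ^ p')).im
        = ∑ i ∈ range (k + 1), (PowerSeries.coeff (2 * i) (G ^ p)).re
          * (PowerSeries.coeff (2 * (k - i) + σ) (G ^ p')).im := by
      have := sum_antidiagonal_parity (fun a => (PowerSeries.coeff a (G ^ p)).re)
        (fun b => (PowerSeries.coeff b (G ^ p')).im) (α := 0) (β := σ) (by norm_num) hσ
        (fun a ha => hP.1 a ha) k
      simpa only [add_zero] using this
    have hIR : ∑ x ∈ antidiagonal (2 * k + σ), (PowerSeries.coeff x.1 (G ^ p)).im
        * (PowerSeries.coeff x.2 (G ^ p')).re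
        = ∑ i ∈ range (k + 1), (PowerSeries.coeff (2 * i + σ) (G ^ p)).im
          * (PowerSeries.coeff (2 * (k - i)) (G ^ p')).re := by
      have := sum_antidiagonal_parity (fun a => (PowerSeries.coeff a (G ^ p)).im)
        (fun b => (PowerSeries.coeff b (G ^ p')).re) (α := σ) (β := 0) hσ (by norm_num)
        (fun a ha => hP.2 a ha) k
      simpa only [add_zero] using this
    have him : (prodIm X Y k : ℝ) = (Mh ! : ℝ) * ((Mh ! : ℝ)
        * (PowerSeries.coeff (2 * k + σ) (G ^ (p + p'))).im) := by
      rw [pow_add, PowerSeries.coeff_mul, Complex.im_sum]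
      simp only [Complex.mul_im]
      rw [sum_add_distrib, hRI, hIR, prodIm]
      push_cast
      have h1 : ∑ i ∈ range (k + 1), (zval X.1 i : ℝ) * (zval Y.2 (k - i) : ℝ)
          = (Mh ! : ℝ) * (Mh ! : ℝ) * ∑ i ∈ range (k + 1),
            (PowerSeries.coeff (2 * i) (G ^ p)).re
              * (PowerSeries.coeff (2 * (k - i) + σ) (G ^ p')).im := by
        rw [mul_sum]
        refine sum_congr rfl fun i hi => ?_
        rw [mem_range] at hi
        rw [hX.re i (by omega), hY.im (k - i) (by omega)]
        ring
      have h2 : ∑ i ∈ range (k + 1), (zval X.2 i : ℝ) * (zval Y.1 (k - i) : ℝ)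
          = (Mh ! : ℝ) * (Mh ! : ℝ) * ∑ i ∈ range (k + 1),
            (PowerSeries.coeff (2 * i + σ) (G ^ p)).im
              * (PowerSeries.coeff (2 * (k - i)) (G ^ p')).re := by
        rw [mul_sum]
        refine sum_congr rfl fun i hi => ?_
        rw [mem_range] at hi
        rw [hX.im i (by omega), hY.re (k - i) (by omega)]
        ring
      rw [h1, h2]
      ring
    obtain ⟨z, hz⟩ := intC_im hI (show 2 * k + σ ≤ Mh by omega)
    rw [hz] at him
    obtain ⟨hdvd, hq⟩ := int_quot_of_real_eq hMf him
    rw [zval_gzMul_im σ (Mh !) (K + 1) X Y hX.len hY.len k (by omega) hdvd, hq, hz]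


/-! ### Binary powering -/

/-- **`gzPowAux` computes the powers**: from the invariant at power `1`, the invariant at every power
`1 ≤ p ≤ fuel + 1`. [cite: FitznerVanDerHofstad2016NoBLE, §5.1.1 (5.4)–(5.5) pp. 1089–1090] -/
theorem twInv_gzPowAux {Mh K σ : ℕ} {G : PowerSeries ℂ} (hσ : σ < 2) (hMh : Mh = 2 * K + 1)
    (hpar : ParityC σ G) (hint : IntC G) {R : GZ} (hR : TwInv Mh K σ G 1 R) :
    ∀ fuel p : ℕ, 1 ≤ p → p ≤ fuel + 1 → TwInv Mh K σ G p (gzPowAux σ (Mh !) (K + 1) R fuel p)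
  | 0, p, h1, h2 => by
      obtain rfl : p = 1 := by omega
      rw [gzPowAux]
      exact hR
  | fuel + 1, p, h1, h2 => by
      rw [gzPowAux]
      cases hb : Nat.ble p 1 with
      | true =>
          obtain rfl : p = 1 := by have := Nat.le_of_ble_eq_true hb; omega
          exact hR
      | false =>
          have hp : ¬ p ≤ 1 := fun h => by rw [Nat.ble_eq_true_of_le h] at hb; exact Bool.noConfusion hb
          by_cases he : p % 2 = 0
          · have hbeq : (p % 2 == 0) = true := by simp [he]
            rw [hbeq]
            have hH := twInv_gzPowAux hσ hMh hpar hint hR fuel (p / 2) (by omega) (by omega)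
            have := twInv_gzMul hσ hMh hpar hint hH hH
            rw [show p / 2 + p / 2 = p by omega] at this
            exact this
          · have hbeq : (p % 2 == 0) = false := by simp [he]
            rw [hbeq]
            have h1' := twInv_gzPowAux hσ hMh hpar hint hR fuel (p - 1) (by omega) (by omega)
            have := twInv_gzMul hσ hMh hpar hint hR h1'
            rw [show 1 + (p - 1) = p by omega] at this
            exact this

/-- **`gzPow` computes `Θ_1^p`** (`1 ≤ p`). [cite: FitznerVanDerHofstad2016NoBLE, §5.1.1 (5.4)–(5.5) pp. 1089–1090] -/
theorem twInv_gzPow {Mh K σ : ℕ} {G : PowerSeries ℂ} (hσ : σ < 2) (hMh : Mh = 2 * K + 1)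
    (hpar : ParityC σ G) (hint : IntC G) {R : GZ} (hR : TwInv Mh K σ G 1 R) (p : ℕ) (hp : 1 ≤ p) :
    TwInv Mh K σ G p (gzPow σ (Mh !) (K + 1) R p) :=
  twInv_gzPowAux hσ hMh hpar hint hR p p hp (by omega)

/-! ### The twisted EGF row -/

/-- `smulN` scales entries. [cite: FitznerVanDerHofstad2016NoBLE, §5.1.1 (5.4)–(5.5) pp. 1089–1090] -/
theorem getD_smulN (c : ℕ) : ∀ (v : List ℕ) (k : ℕ), (smulN c v).getD k 0 = c * v.getD k 0
  | [], k => by simp [smulN]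
  | x :: xs, 0 => by simp [smulN]
  | x :: xs, k + 1 => by simp only [smulN, List.getD_cons_succ]; exact getD_smulN c xs k

/-- Entries of `rowTerm` (`k ≤ K`). [cite: FitznerVanDerHofstad2016NoBLE, §5.1.1 (5.4)–(5.5) pp. 1089–1090] -/
theorem getD_rowTerm (Mf K a shift cabs k : ℕ) (hk : k ≤ K) :
    (rowTerm Mf K a shift cabs).getD k 0
      = cabs * (if k < shift then 0 else Mf / ((k - shift)! * (k - shift + a)!)) := by
  rw [rowTerm, getD_take_of_lt _ (Nat.lt_succ_of_le hk), getD_replicate_append]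
  split_ifs with h
  · simp
  · rw [getD_smulN, hatRow1_getD Mf a K (k - shift) (by omega)]

/-- `rowTerm` has length `K+1`. [cite: FitznerVanDerHofstad2016NoBLE, §5.1.1 (5.4)–(5.5) pp. 1089–1090] -/
theorem length_rowTerm (Mf K a shift cabs : ℕ) : (rowTerm Mf K a shift cabs).length = K + 1 := by
  simp only [rowTerm, List.length_take, List.length_append, List.length_replicate, length_smulN,
    length_hatRow1]
  omega

/-- The multiplicity `ε_j` of order index `j` (`ε_0 = 1`, `ε_j = 2`: orders `± jm`). [cite: FitznerVanDerHofstad2016NoBLE, §5.1.1 (5.4)–(5.5) pp. 1089–1090] -/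
def epsN (j : ℕ) : ℕ := if j = 0 then 1 else 2

/-- The sign used by the kernel for order index `j`: `-` iff (`Q_j < 0`) xor (`j mod 4 ≥ 2`). [cite: FitznerVanDerHofstad2016NoBLE, §5.1.1 (5.4)–(5.5) pp. 1089–1090] -/
def rtSign (Q : ℕ → ℤ) (j : ℕ) : ℤ := if xor (decide (Q j < 0)) (decide (2 ≤ j % 4)) then -1 else 1

/-- `rtSign_j · ε_j |Q_j| = (-1)^{[j mod 4 ≥ 2]} ε_j Q_j`. [cite: FitznerVanDerHofstad2016NoBLE, §5.1.1 (5.4)–(5.5) pp. 1089–1090] -/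
theorem rtSign_mul_cabs (Q : ℕ → ℤ) (j e : ℕ) :
    rtSign Q j * ((e * (Q j).natAbs : ℕ) : ℤ) = (if 2 ≤ j % 4 then -1 else 1) * (e : ℤ) * Q j := by
  unfold rtSign
  rcases lt_or_ge (Q j) 0 with hq | hq
  · rw [Nat.cast_mul, Int.ofNat_natAbs_of_nonpos hq.le, decide_eq_true hq]
    by_cases h4 : 2 ≤ j % 4
    · rw [decide_eq_true h4, if_pos h4]; simp
    · rw [decide_eq_false h4, if_neg h4]; simp
  · rw [Nat.cast_mul, Int.natAbs_of_nonneg hq, decide_eq_false (not_lt.2 hq)]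
    by_cases h4 : 2 ≤ j % 4
    · rw [decide_eq_true h4, if_pos h4]; simp
    · rw [decide_eq_false h4, if_neg h4]; simp

/-- Value of a one-sided signed pair. [cite: FitznerVanDerHofstad2016NoBLE, §5.1.1 (5.4)–(5.5) pp. 1089–1090] -/
theorem zval_bif (neg : Bool) (z t : List ℕ) (hz : ∀ k, z.getD k 0 = 0) (k : ℕ) :
    zval (bif neg then (z, t) else (t, z)) k = (if neg then -1 else 1) * (t.getD k 0 : ℤ) := by
  cases neg
  · show (t.getD k 0 : ℤ) - (z.getD k 0 : ℤ) = _
    rw [hz k]; simp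
  · show (z.getD k 0 : ℤ) - (t.getD k 0 : ℤ) = _
    rw [hz k]; simp

/-- Real part of `rowTermGZ j`: present iff `j` is even. [cite: FitznerVanDerHofstad2016NoBLE, §5.1.1 (5.4)–(5.5) pp. 1089–1090] -/
theorem zval_rowTermGZ_re (Mf K σ m : ℕ) (Q : ℕ → ℤ) (j k : ℕ) :
    zval (rowTermGZ Mf K σ m Q j).1 k = if j % 2 = 0 then
      rtSign Q j * ((rowTerm Mf K (j * m) (j * m / 2) (epsN j * (Q j).natAbs)).getD k 0 : ℤ)
      else 0 := by
  unfold rowTermGZ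
  by_cases hj : j % 2 = 0
  · simp only [hj, if_true]
    exact zval_bif _ _ _ (getD_replicate_zero (K + 1)) k
  · simp only [hj, if_false, zval, getD_replicate_zero]
    simp

/-- Imaginary part of `rowTermGZ j`: present iff `j` is odd. [cite: FitznerVanDerHofstad2016NoBLE, §5.1.1 (5.4)–(5.5) pp. 1089–1090] -/
theorem zval_rowTermGZ_im (Mf K σ m : ℕ) (Q : ℕ → ℤ) (j k : ℕ) :
    zval (rowTermGZ Mf K σ m Q j).2 k = if j % 2 = 0 then 0 else
      rtSign Q j * ((rowTerm Mf K (j * m) ((j * m - σ) / 2)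
        (epsN j * (Q j).natAbs)).getD k 0 : ℤ) := by
  unfold rowTermGZ
  by_cases hj : j % 2 = 0
  · simp only [hj, if_true, zval, getD_replicate_zero]
    simp
  · simp only [hj, if_false]
    exact zval_bif _ _ _ (getD_replicate_zero (K + 1)) k

/-- All parts of `rowTermGZ j` have length `K+1`. [cite: FitznerVanDerHofstad2016NoBLE, §5.1.1 (5.4)–(5.5) pp. 1089–1090] -/
theorem rowTermGZ_len (Mf K σ m : ℕ) (Q : ℕ → ℤ) (j : ℕ) : GZlen (rowTermGZ Mf K σ m Q j) (K + 1) := by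
  unfold rowTermGZ GZlen
  simp only []
  split_ifs <;> cases (xor (decide (Q j < 0)) (decide (2 ≤ j % 4))) <;>
    simp [length_rowTerm]

/-- `gzSum` adds values and keeps lengths. [cite: FitznerVanDerHofstad2016NoBLE, §5.1.1 (5.4)–(5.5) pp. 1089–1090] -/
theorem zval_gzSum (f : ℕ → GZ) (k : ℕ) : ∀ (n : ℕ) (acc : GZ),
    zval (gzSum f n acc).1 k = zval acc.1 k + ∑ j ∈ range n, zval (f j).1 k ∧
      zval (gzSum f n acc).2 k = zval acc.2 k + ∑ j ∈ range n, zval (f j).2 k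
  | 0, acc => by simp [gzSum]
  | n + 1, acc => by
      rw [gzSum]
      obtain ⟨h1, h2⟩ := zval_gzSum f k n (gzAdd (f n) acc)
      rw [h1, h2, gzAdd, zval_addPN, zval_addPN, sum_range_succ, sum_range_succ]
      constructor <;> ring

/-- `gzSum` keeps lengths `L`. [cite: FitznerVanDerHofstad2016NoBLE, §5.1.1 (5.4)–(5.5) pp. 1089–1090] -/
theorem gzSum_len (f : ℕ → GZ) (L : ℕ) (hf : ∀ j, GZlen (f j) L) : ∀ (n : ℕ) (acc : GZ),
    GZlen acc L → GZlen (gzSum f n acc) L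
  | 0, acc, h => by simpa [gzSum] using h
  | n + 1, acc, h => by
      rw [gzSum]
      refine gzSum_len f L hf n _ ?_
      obtain ⟨h1, h2, h3, h4⟩ := h
      obtain ⟨g1, g2, g3, g4⟩ := hf n
      refine ⟨?_, ?_, ?_, ?_⟩ <;>
        simp only [gzAdd, (length_addPN _ _).1, (length_addPN _ _).2, h1, h2, h3, h4, g1, g2, g3, g4,
          max_self]

/-- **The twisted row numerator** `φ(N) = Σ_{j ≤ J} ε_j i^j Q_j walk1(N, jm) ∈ ℤ[i]`.
[cite: FitznerVanDerHofstad2016NoBLE, §5.1.1 (5.4)–(5.5) pp. 1089–1090] -/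
noncomputable def twRowC (m J : ℕ) (Q : ℕ → ℤ) (N : ℕ) : ℂ :=
  ∑ j ∈ range (J + 1), (epsN j : ℂ) * Complex.I ^ j * (Q j : ℂ) * (SrwCount.walk1 N ((j * m : ℕ) : ℤ) : ℂ)

/-- **The formal twisted EGF** `G(s) = Σ_N φ(N) s^N / N!`. [cite: FitznerVanDerHofstad2016NoBLE, §5.1.1 (5.4)–(5.5) pp. 1089–1090] -/
noncomputable def twG (m J : ℕ) (Q : ℕ → ℤ) : PowerSeries ℂ :=
  PowerSeries.mk fun N => twRowC m J Q N / (N ! : ℂ)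

/-- The real sign of `i^j`: `(-1)^{j/2}` for even `j`, `0` for odd `j`. [cite: FitznerVanDerHofstad2016NoBLE, §5.1.1 (5.4)–(5.5) pp. 1089–1090] -/
def reSign (j : ℕ) : ℤ := if j % 2 = 0 then (if 2 ≤ j % 4 then -1 else 1) else 0

/-- The imaginary sign of `i^j`: `(-1)^{(j-1)/2}` for odd `j`, `0` for even `j`. [cite: FitznerVanDerHofstad2016NoBLE, §5.1.1 (5.4)–(5.5) pp. 1089–1090] -/
def imSign (j : ℕ) : ℤ := if j % 2 = 0 then 0 else (if 2 ≤ j % 4 then -1 else 1)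

/-- `i^j = reSign j + imSign j · i`. [cite: FitznerVanDerHofstad2016NoBLE, §5.1.1 (5.4)–(5.5) pp. 1089–1090] -/
theorem I_pow_eq (j : ℕ) : Complex.I ^ j = (reSign j : ℂ) + (imSign j : ℂ) * Complex.I := by
  rw [← Nat.div_add_mod j 4, pow_add, pow_mul, Complex.I_pow_four, one_pow, one_mul]
  have h4 : j % 4 < 4 := Nat.mod_lt _ (by norm_num)
  unfold reSign imSign
  rw [show (4 * (j / 4) + j % 4) % 2 = j % 4 % 2 by omega,
    show (4 * (j / 4) + j % 4) % 4 = j % 4 by omega]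
  interval_cases (j % 4)
  · simp
  · simp
  · simp [Complex.I_sq]
  · simp [pow_succ]

/-- Real part of `φ(N)`. [cite: FitznerVanDerHofstad2016NoBLE, §5.1.1 (5.4)–(5.5) pp. 1089–1090] -/
theorem twRowC_re (m J : ℕ) (Q : ℕ → ℤ) (N : ℕ) :
    (twRowC m J Q N).re = ∑ j ∈ range (J + 1),
      (epsN j : ℝ) * (reSign j : ℝ) * (Q j : ℝ) * (SrwCount.walk1 N ((j * m : ℕ) : ℤ) : ℝ) := by
  rw [twRowC, Complex.re_sum]
  refine sum_congr rfl fun j _ => ?_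
  rw [I_pow_eq]
  simp

/-- Imaginary part of `φ(N)`. [cite: FitznerVanDerHofstad2016NoBLE, §5.1.1 (5.4)–(5.5) pp. 1089–1090] -/
theorem twRowC_im (m J : ℕ) (Q : ℕ → ℤ) (N : ℕ) :
    (twRowC m J Q N).im = ∑ j ∈ range (J + 1),
      (epsN j : ℝ) * (imSign j : ℝ) * (Q j : ℝ) * (SrwCount.walk1 N ((j * m : ℕ) : ℤ) : ℝ) := by
  rw [twRowC, Complex.im_sum]
  refine sum_congr rfl fun j _ => ?_
  rw [I_pow_eq]
  simp

/-- Coefficients of `twG`. [cite: FitznerVanDerHofstad2016NoBLE, §5.1.1 (5.4)–(5.5) pp. 1089–1090] -/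
theorem coeff_twG (m J : ℕ) (Q : ℕ → ℤ) (N : ℕ) :
    PowerSeries.coeff N (twG m J Q) = twRowC m J Q N / (N ! : ℂ) := by
  rw [twG, PowerSeries.coeff_mk]

/-- `walk1 N (jm) = 0` unless `N ≡ jm (mod 2)`. [cite: FitznerVanDerHofstad2016NoBLE, §5.1.1 (5.4)–(5.5) pp. 1089–1090] -/
theorem walk1_eq_zero_of_parity (N a : ℕ) (h : N % 2 ≠ a % 2) : SrwCount.walk1 N (a : ℤ) = 0 :=
  SrwCount.walk1_eq_zero_off N (a : ℤ) fun k hk => by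
    rw [Int.natAbs_natCast] at hk
    omega

/-- **`twG` has the parity structure** with `σ = m mod 2`. [cite: FitznerVanDerHofstad2016NoBLE, §5.1.1 (5.4)–(5.5) pp. 1089–1090] -/
theorem parityC_twG (m J : ℕ) (Q : ℕ → ℤ) : ParityC (m % 2) (twG m J Q) := by
  constructor
  · intro N hN
    rw [coeff_twG, ← Complex.ofReal_natCast, Complex.div_ofReal_re, twRowC_re]
    rw [sum_eq_zero, zero_div]
    intro j _
    by_cases hj : j % 2 = 0
    · rw [walk1_eq_zero_of_parity N (j * m) (by
        have : (j * m) % 2 = 0 := by rw [Nat.mul_mod, hj, zero_mul, Nat.zero_mod]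
        omega)]
      simp
    · simp [reSign, hj]
  · intro N hN
    rw [coeff_twG, ← Complex.ofReal_natCast, Complex.div_ofReal_im, twRowC_im]
    rw [sum_eq_zero, zero_div]
    intro j _
    by_cases hj : j % 2 = 0
    · simp [imSign, hj]
    · have hjm : (j * m) % 2 = m % 2 := by
        rw [Nat.mul_mod, show j % 2 = 1 by omega, one_mul, Nat.mod_mod]
      rw [walk1_eq_zero_of_parity N (j * m) (by omega)]
      simp

/-- **`twG` has Gaussian-integer numerators.** [cite: FitznerVanDerHofstad2016NoBLE, §5.1.1 (5.4)–(5.5) pp. 1089–1090] -/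
theorem intC_twG (m J : ℕ) (Q : ℕ → ℤ) : IntC (twG m J Q) := by
  intro N
  have hN : (N ! : ℂ) ≠ 0 := by exact_mod_cast (Nat.factorial_pos N).ne'
  rw [coeff_twG, mul_div_cancel₀ _ hN]
  refine ⟨∑ j ∈ range (J + 1), (epsN j : ℤ) * reSign j * Q j * (SrwCount.walk1 N ((j * m : ℕ) : ℤ) : ℤ),
    ∑ j ∈ range (J + 1), (epsN j : ℤ) * imSign j * Q j * (SrwCount.walk1 N ((j * m : ℕ) : ℤ) : ℤ), ?_⟩
  apply Complex.ext
  · rw [twRowC_re]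
    simp only [Complex.add_re, Complex.mul_re, Complex.intCast_re, Complex.intCast_im, Complex.I_re,
      Complex.I_im, mul_zero, sub_zero, zero_mul, add_zero]
    push_cast
    rfl
  · rw [twRowC_im]
    simp only [Complex.add_im, Complex.mul_im, Complex.intCast_re, Complex.intCast_im, Complex.I_re,
      Complex.I_im, mul_one, zero_add, zero_mul, add_zero]
    push_cast
    rfl


/-- **The hat-row entry is the normalised walk count**: for `a = 2s + off`, `2k + off ≤ Mh`,
`[k ≥ s] · Mh!/((k-s)!(k-s+a)!) = Mh! · walk1(2k+off, a)/(2k+off)!` (exact). [cite: FitznerVanDerHofstad2016NoBLE, §5.1.1 (5.4)–(5.5) pp. 1089–1090] -/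
theorem hat_real (Mh a s off k : ℕ) (ha : a = 2 * s + off) (hN : 2 * k + off ≤ Mh) :
    ((if k < s then 0 else Mh ! / ((k - s)! * (k - s + a)!) : ℕ) : ℝ)
      = (Mh ! : ℝ) * (SrwCount.walk1 (2 * k + off) (a : ℤ) : ℝ) / ((2 * k + off)! : ℝ) := by
  by_cases hk : k < s
  · rw [if_pos hk, SrwCount.walk1_eq_zero_off (2 * k + off) (a : ℤ) fun k' hk' => by
      rw [Int.natAbs_natCast] at hk'; omega]
    simp
  · rw [if_neg hk]
    obtain ⟨i, rfl⟩ : ∃ i, k = s + i := ⟨k - s, by omega⟩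
    have hN' : 2 * (s + i) + off = 2 * i + a := by omega
    rw [hN', show s + i - s = i by omega]
    have hw : SrwCount.walk1 (2 * i + a) (a : ℤ) = (2 * i + a).choose i := by
      have := SrwCount.walk1_two_mul_add_natAbs i (a : ℤ)
      rwa [Int.natAbs_natCast] at this
    rw [hw]
    have hdvd : i ! * (i + a)! ∣ Mh ! := by
      have h1 := Nat.factorial_mul_factorial_dvd_factorial_add i (i + a)
      rw [show i + (i + a) = 2 * i + a by ring] at h1
      exact h1.trans (Nat.factorial_dvd_factorial (by omega))
    rw [Nat.cast_div hdvd (by positivity)]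
    have hc := Nat.choose_mul_factorial_mul_factorial (show i ≤ 2 * i + a by omega)
    rw [show 2 * i + a - i = i + a by omega] at hc
    have hc' : ((2 * i + a)! : ℝ) = ((2 * i + a).choose i : ℝ) * (i ! : ℝ) * ((i + a)! : ℝ) := by
      exact_mod_cast hc.symm
    rw [hc', Nat.cast_mul]
    have : (i ! : ℝ) ≠ 0 := by positivity
    have : ((i + a)! : ℝ) ≠ 0 := by positivity
    have : ((2 * i + a).choose i : ℝ) ≠ 0 := by exact_mod_cast (Nat.choose_pos (by omega)).ne'
    field_simp

/-- `reSign` of an even index. [cite: FitznerVanDerHofstad2016NoBLE, §5.1.1 (5.4)–(5.5) pp. 1089–1090] -/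
theorem reSign_of_even {j : ℕ} (hj : j % 2 = 0) : reSign j = if 2 ≤ j % 4 then -1 else 1 := by
  simp [reSign, hj]

/-- `imSign` of an odd index. [cite: FitznerVanDerHofstad2016NoBLE, §5.1.1 (5.4)–(5.5) pp. 1089–1090] -/
theorem imSign_of_odd {j : ℕ} (hj : ¬ j % 2 = 0) : imSign j = if 2 ≤ j % 4 then -1 else 1 := by
  simp [imSign, hj]

/-- **The row `Θ_1` is the twisted EGF row**: `TwInv` at power `1` for `gzRow`.
[cite: FitznerVanDerHofstad2016NoBLE, §5.1.1 (5.4)–(5.5) pp. 1089–1090] -/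
theorem twInv_gzRow (Mh K σ m J : ℕ) (Q : ℕ → ℤ) (hMh : Mh = 2 * K + 1) (hσ : σ = m % 2) :
    TwInv Mh K σ (twG m J Q) 1 (gzRow (Mh !) K σ m J Q) := by
  have hz0 : ∀ k, (List.replicate (K + 1) 0).getD k 0 = 0 := getD_replicate_zero (K + 1)
  have hlen : GZlen (gzSum (rowTermGZ (Mh !) K σ m Q) (J + 1) (zeroPN (K + 1), zeroPN (K + 1))) (K + 1) :=
    gzSum_len _ (K + 1) (rowTermGZ_len (Mh !) K σ m Q) (J + 1) _
      ⟨by simp [zeroPN], by simp [zeroPN], by simp [zeroPN], by simp [zeroPN]⟩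
  have hzv1 : ∀ k, zval (zeroPN (K + 1), zeroPN (K + 1)).1 k = 0 := fun k => by simp [zval, zeroPN]
  have hzv2 : ∀ k, zval (zeroPN (K + 1), zeroPN (K + 1)).2 k = 0 := fun k => by simp [zval, zeroPN]
  refine ⟨?_, ?_, ?_⟩
  · obtain ⟨h1, h2, h3, h4⟩ := hlen
    refine ⟨?_, ?_, ?_, ?_⟩ <;>
      simp only [gzRow, forcePN_eq, (length_normPN _).1, (length_normPN _).2, h1, h2, h3, h4, max_self]
  · intro k hk
    rw [pow_one, coeff_twG, ← Complex.ofReal_natCast, Complex.div_ofReal_re, twRowC_re]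
    simp only [gzRow, forcePN_eq]
    rw [zval_normPN, (zval_gzSum _ k (J + 1) _).1, hzv1, zero_add, Int.cast_sum, sum_div, mul_sum]
    refine sum_congr rfl fun j _ => ?_
    rw [zval_rowTermGZ_re]
    by_cases hj : j % 2 = 0
    · have ha : j * m = 2 * (j * m / 2) + 0 := by
        have : (j * m) % 2 = 0 := by rw [Nat.mul_mod, hj, zero_mul, Nat.zero_mod]
        omega
      have hE := hat_real Mh (j * m) (j * m / 2) 0 k ha (by omega)
      rw [if_pos hj, getD_rowTerm _ _ _ _ _ _ hk, Nat.cast_mul, ← mul_assoc, rtSign_mul_cabs,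
        reSign_of_even hj, Int.cast_mul, Int.cast_natCast, hE]
      push_cast
      simp only [add_zero]
      ring
    · rw [if_neg hj]
      simp [reSign, hj]
  · intro k hk
    rw [pow_one, coeff_twG, ← Complex.ofReal_natCast, Complex.div_ofReal_im, twRowC_im]
    simp only [gzRow, forcePN_eq]
    rw [zval_normPN, (zval_gzSum _ k (J + 1) _).2, hzv2, zero_add, Int.cast_sum, sum_div, mul_sum]
    refine sum_congr rfl fun j _ => ?_
    rw [zval_rowTermGZ_im]
    by_cases hj : j % 2 = 0
    · rw [if_pos hj]
      simp [imSign, hj]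
    · have hσ2 : σ < 2 := by rw [hσ]; exact Nat.mod_lt _ two_pos
      have ha : j * m = 2 * ((j * m - σ) / 2) + σ := by
        have h1 : (j * m) % 2 = σ := by
          rw [Nat.mul_mod, show j % 2 = 1 by omega, one_mul, Nat.mod_mod, hσ]
        omega
      have hE := hat_real Mh (j * m) ((j * m - σ) / 2) σ k ha (by omega)
      rw [if_neg hj, getD_rowTerm _ _ _ _ _ _ hk, Nat.cast_mul, ← mul_assoc, rtSign_mul_cabs,
        imSign_of_odd hj, Int.cast_mul, Int.cast_natCast, hE]
      push_cast
      ring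


/-- **The power table is `Θ_1^D`**: `TwInv` at power `D ≥ 1` for `gzTable`.
[cite: FitznerVanDerHofstad2016NoBLE, §5.1.1 (5.4)–(5.5) pp. 1089–1090] -/
theorem twInv_gzTable (K m J D : ℕ) (Q : ℕ → ℤ) (hD : 1 ≤ D) :
    TwInv (2 * K + 1) K (m % 2) (twG m J Q) D (gzTable ((2 * K + 1)!) K (m % 2) m J Q D) :=
  twInv_gzPow (Nat.mod_lt _ two_pos) rfl (parityC_twG m J Q) (intC_twG m J Q)
    (twInv_gzRow (2 * K + 1) K (m % 2) m J Q rfl rfl) D hD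

/-- **The certificate's table is `Θ_1^D`** (with `Mf = prodRange 0 Mh = Mh!`).
[cite: FitznerVanDerHofstad2016NoBLE, §5.1.1 (5.4)–(5.5) pp. 1089–1090] -/
theorem TwCert.twInv_table (c : TwCert) (D : ℕ) (hD : 1 ≤ D) :
    TwInv c.Mh c.K c.sigma (twG c.m c.J c.Q) D (gzTable (prodRange 0 c.Mh) c.K c.sigma c.m c.J c.Q D) := by
  rw [prodRange_zero]
  exact twInv_gzTable c.K c.m c.J D c.Q hD


/-! ### Part 4: the Horner sums `P_n`, `U_n` are the exact truncated moment sums of the table -/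

/-- `hornerAuxB B w f acc = acc·B^{|f|} + Σ_{i<|f|} w_i f_i B^{|f|-1-i}` (`|f| ≤ |w|`; re-proved, the
upstream copy is private). [cite: FitznerVanDerHofstad2016NoBLE, §5.1.1 (5.4)–(5.5) pp. 1089–1090] -/
private theorem hornerAuxB_eq' (B : ℕ) : ∀ (w f : List ℕ) (acc : ℕ), f.length ≤ w.length →
    hornerAuxB B w f acc = acc * B ^ f.length
      + ∑ i ∈ range f.length, w.getD i 0 * f.getD i 0 * B ^ (f.length - 1 - i)
  | [], [], acc, _ => by simp [hornerAuxB]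
  | _ :: _, [], acc, _ => by simp [hornerAuxB]
  | [], f :: fs, acc, h => by simp at h
  | w :: ws, f :: fs, acc, h => by
      rw [hornerAuxB, hornerAuxB_eq' B ws fs _ (by simpa using h)]
      simp only [List.length_cons]
      rw [sum_range_succ']
      simp only [List.getD_cons_succ, List.getD_cons_zero]
      have e1 : ∀ i, fs.length + 1 - 1 - (i + 1) = fs.length - 1 - i := by intro i; omega
      simp only [e1, show fs.length + 1 - 1 - 0 = fs.length by omega, pow_succ]
      ring

namespace TwCert

variable (c : TwCert) (D : ℕ)

/-- The signed Horner numerator of `P_n`: `N(w⁺) − N(w⁻) = Σ_{i<cnt} zval w i · (n'+2i)! · B^{K-i}`.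
[cite: FitznerVanDerHofstad2016NoBLE, §5.1.1 (5.4)–(5.5) pp. 1089–1090] -/
theorem NPT_diffQ (w : List ℕ × List ℕ) (n : ℕ) (h1 : c.cnt n ≤ w.1.length)
    (h2 : c.cnt n ≤ w.2.length) (hK : c.cnt n ≤ c.K + 1) :
    (c.NPT D w.1 n : ℚ) - (c.NPT D w.2 n : ℚ) = ∑ i ∈ range (c.cnt n),
      (zval w i : ℚ) * (((n - 1) + 2 * i)! : ℚ) * ((baseT D : ℕ) : ℚ) ^ (c.K - i) := by
  have e1 := hornerAuxB_eq' (baseT D) w.1 (facSeq (n - 1) (c.cnt n)) 0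
    (by rw [length_facSeq]; exact h1)
  have e2 := hornerAuxB_eq' (baseT D) w.2 (facSeq (n - 1) (c.cnt n)) 0
    (by rw [length_facSeq]; exact h2)
  rw [NPT, NPT, hornerB, hornerB, e1, e2, length_facSeq, zero_mul, zero_add, zero_add]
  push_cast
  rw [Finset.mul_sum, Finset.mul_sum, ← Finset.sum_sub_distrib]
  refine sum_congr rfl fun i hi => ?_
  rw [mem_range] at hi
  rw [facSeq_getD _ _ _ hi]
  have hpow : ((baseT D : ℕ) : ℚ) ^ (c.K + 1 - c.cnt n) * ((baseT D : ℕ) : ℚ) ^ (c.cnt n - 1 - i)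
      = ((baseT D : ℕ) : ℚ) ^ (c.K - i) := by
    rw [← pow_add]; congr 1; omega
  rw [zval, ← hpow]
  push_cast
  ring

/-- The signed Horner numerator of `U_n`: `N(w⁺) − N(w⁻) = Σ_{i<cnt} zval w i · (n'+2i)! E_{n'+2i+1}(λ) · B^{K-i}`.
[cite: FitznerVanDerHofstad2016NoBLE, §5.1.1 (5.4)–(5.5) pp. 1089–1090] -/
theorem NUT_diffQ (w : List ℕ × List ℕ) (n : ℕ) (h1 : c.cnt n ≤ w.1.length)
    (h2 : c.cnt n ≤ w.2.length) (hK : c.cnt n ≤ c.K + 1) :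
    (c.NUT D w.1 n : ℚ) - (c.NUT D w.2 n : ℚ) = ∑ i ∈ range (c.cnt n),
      (zval w i : ℚ) * ((((n - 1) + 2 * i)! : ℚ) * EQ (c.lamT D) ((n - 1) + 2 * i + 1))
        * ((baseT D : ℕ) : ℚ) ^ (c.K - i) := by
  have e1 := hornerAuxB_eq' (baseT D) w.1 (expSeq (c.lamT D) (n - 1) (c.cnt n)) 0
    (by rw [length_expSeq]; exact h1)
  have e2 := hornerAuxB_eq' (baseT D) w.2 (expSeq (c.lamT D) (n - 1) (c.cnt n)) 0
    (by rw [length_expSeq]; exact h2)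
  rw [NUT, NUT, hornerB, hornerB, e1, e2, length_expSeq, zero_mul, zero_add, zero_add]
  push_cast
  rw [Finset.mul_sum, Finset.mul_sum, ← Finset.sum_sub_distrib]
  refine sum_congr rfl fun i hi => ?_
  rw [mem_range] at hi
  rw [expSeq_getD _ _ _ _ hi]
  have hpow : ((baseT D : ℕ) : ℚ) ^ (c.K + 1 - c.cnt n) * ((baseT D : ℕ) : ℚ) ^ (c.cnt n - 1 - i)
      = ((baseT D : ℕ) : ℚ) ^ (c.K - i) := by
    rw [← pow_add]; congr 1; omega
  rw [zval, ← hpow]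
  push_cast
  ring

/-- The base-power bookkeeping `B^{K-i} · (2D)^{2i} = (2D)^{2K}` (`i ≤ K`). [cite: FitznerVanDerHofstad2016NoBLE, §5.1.1 (5.4)–(5.5) pp. 1089–1090] -/
theorem baseT_pow {i : ℕ} (hi : i ≤ c.K) :
    ((baseT D : ℕ) : ℚ) ^ (c.K - i) * (((2 * D : ℕ) : ℚ)) ^ (2 * i) = (((2 * D : ℕ) : ℚ)) ^ (2 * c.K) := by
  rw [baseT]
  push_cast
  rw [← pow_mul, ← pow_add]
  congr 1; omega

/-- **`P_n` exactly**: `P_n = Σ_{i<cnt n} zval(re)_i (n'+2i)! / (n'! · M̂! · (2D)^{2i} · qden^D)`.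
[cite: FitznerVanDerHofstad2016NoBLE, §5.1.1 (5.4)–(5.5) pp. 1089–1090] -/
theorem PqT_eq (re : List ℕ × List ℕ) (n : ℕ) (h1 : c.cnt n ≤ re.1.length)
    (h2 : c.cnt n ≤ re.2.length) (hK : c.cnt n ≤ c.K + 1) (hD : 1 ≤ D) (hq : 0 < c.qden) :
    c.PqT D re n = ∑ i ∈ range (c.cnt n), (zval re i : ℚ) * (((n - 1) + 2 * i)! : ℚ)
      / ((((n - 1))! : ℚ) * (c.Mh ! : ℚ) * (((2 * D : ℕ) : ℚ)) ^ (2 * i) * (c.qden : ℚ) ^ D) := by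
  rw [PqT, c.NPT_diffQ D re n h1 h2 hK, denT, prodRange_zero, Finset.sum_div]
  refine sum_congr rfl fun i hi => ?_
  rw [mem_range] at hi
  have hD0 : (((2 * D : ℕ) : ℚ)) ≠ 0 := by positivity
  have hB : ((baseT D : ℕ) : ℚ) ^ (c.K - i) ≠ 0 := by
    rw [baseT]; push_cast; exact pow_ne_zero _ (pow_ne_zero _ (by exact_mod_cast hD0))
  have hq' : (c.qden : ℚ) ^ D ≠ 0 := by positivity
  have hf2 : (((n - 1))! : ℚ) ≠ 0 := by positivity
  have hf3 : ((c.Mh)! : ℚ) ≠ 0 := by positivity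
  rw [div_eq_div_iff (by positivity) (by positivity), ← c.baseT_pow D (show i ≤ c.K by omega)]
  ring

/-- **`U_n` exactly**: `U_n = Σ_{i<cnt n} zval(re)_i (n'+2i)! E_{n'+2i+1}(λ) / (n'! · M̂! · (2D)^{2i} · qden^D)`.
[cite: FitznerVanDerHofstad2016NoBLE, §5.1.1 (5.4)–(5.5) pp. 1089–1090] -/
theorem UqT_eq (re : List ℕ × List ℕ) (n : ℕ) (h1 : c.cnt n ≤ re.1.length)
    (h2 : c.cnt n ≤ re.2.length) (hK : c.cnt n ≤ c.K + 1) (hD : 1 ≤ D) (hq : 0 < c.qden) :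
    c.UqT D re n = ∑ i ∈ range (c.cnt n), (zval re i : ℚ) * (((n - 1) + 2 * i)! : ℚ)
      * EQ (c.lamT D) ((n - 1) + 2 * i + 1)
      / ((((n - 1))! : ℚ) * (c.Mh ! : ℚ) * (((2 * D : ℕ) : ℚ)) ^ (2 * i) * (c.qden : ℚ) ^ D) := by
  rw [UqT, c.NUT_diffQ D re n h1 h2 hK, denT, prodRange_zero, Finset.sum_div]
  refine sum_congr rfl fun i hi => ?_
  rw [mem_range] at hi
  have hD0 : (((2 * D : ℕ) : ℚ)) ≠ 0 := by positivity
  have hB : ((baseT D : ℕ) : ℚ) ^ (c.K - i) ≠ 0 := by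
    rw [baseT]; push_cast; exact pow_ne_zero _ (pow_ne_zero _ (by exact_mod_cast hD0))
  have hq' : (c.qden : ℚ) ^ D ≠ 0 := by positivity
  have hf2 : (((n - 1))! : ℚ) ≠ 0 := by positivity
  have hf3 : ((c.Mh)! : ℚ) ≠ 0 := by positivity
  rw [div_eq_div_iff (by positivity) (by positivity), ← c.baseT_pow D (show i ≤ c.K by omega)]
  ring

/-- **`P_n` of the certificate's table, in `ℝ`, against the formal EGF**:
`P_n = Σ_{i<cnt n} C(2i+n', n') · (2i)! Re [s^{2i}] G^D / ((2D)^{2i} qden^D)`.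
[cite: FitznerVanDerHofstad2016NoBLE, §5.1.1 (5.4)–(5.5) pp. 1089–1090] -/
theorem PqT_table_real (n : ℕ) (hK : c.cnt n ≤ c.K + 1) (hD : 1 ≤ D) (hq : 0 < c.qden) :
    ((c.PqT D (c.tableRe D) n : ℚ) : ℝ) = ∑ i ∈ range (c.cnt n),
      (((2 * i + (n - 1)).choose (n - 1) : ℕ) : ℝ) * (((2 * i)! : ℝ)
        * (PowerSeries.coeff (2 * i) (twG c.m c.J c.Q ^ D)).re)
        / ((((2 * D : ℕ) : ℝ)) ^ (2 * i) * (c.qden : ℝ) ^ D) := by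
  have hT := c.twInv_table D hD
  obtain ⟨l1, l2, _, _⟩ := hT.len
  have h1 : c.cnt n ≤ (c.tableRe D).1.length := by rw [tableRe, l1]; exact hK
  have h2 : c.cnt n ≤ (c.tableRe D).2.length := by rw [tableRe, l2]; exact hK
  rw [c.PqT_eq D _ n h1 h2 hK hD hq]
  push_cast
  refine sum_congr rfl fun i hi => ?_
  rw [mem_range] at hi
  have hre := hT.re i (by omega)
  rw [tableRe, hre]
  have hch : (((2 * i + (n - 1)).choose (n - 1) : ℕ) : ℝ)
      = ((2 * i + (n - 1))! : ℝ) / (((2 * i)! : ℝ) * ((n - 1)! : ℝ)) := by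
    rw [eq_div_iff (by positivity), ← mul_assoc]
    exact_mod_cast Nat.add_choose_mul_factorial_mul_factorial (2 * i) (n - 1)
  rw [hch, show (n - 1) + 2 * i = 2 * i + (n - 1) by ring]
  have hf1 : (((2 * i))! : ℝ) ≠ 0 := by positivity
  have hf2 : (((n - 1))! : ℝ) ≠ 0 := by positivity
  have hf3 : ((c.Mh)! : ℝ) ≠ 0 := by positivity
  have hD0 : (((2 * D : ℕ) : ℝ)) ^ (2 * i) ≠ 0 := by positivity
  have hq' : (c.qden : ℝ) ^ D ≠ 0 := by positivity
  field_simp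

/-- **`U_n` of the certificate's table, in `ℝ`, against the formal EGF**:
`U_n = Σ_{i<cnt n} C(2i+n', n') · (2i)! Re [s^{2i}] G^D / ((2D)^{2i} qden^D) · E_{2i+n'+1}(λ)`.
[cite: FitznerVanDerHofstad2016NoBLE, §5.1.1 (5.4)–(5.5) pp. 1089–1090] -/
theorem UqT_table_real (n : ℕ) (hK : c.cnt n ≤ c.K + 1) (hD : 1 ≤ D) (hq : 0 < c.qden) :
    ((c.UqT D (c.tableRe D) n : ℚ) : ℝ) = ∑ i ∈ range (c.cnt n),
      (((2 * i + (n - 1)).choose (n - 1) : ℕ) : ℝ) * (((2 * i)! : ℝ)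
        * (PowerSeries.coeff (2 * i) (twG c.m c.J c.Q ^ D)).re)
        / ((((2 * D : ℕ) : ℝ)) ^ (2 * i) * (c.qden : ℝ) ^ D)
        * ((EQ (c.lamT D) (2 * i + (n - 1) + 1) : ℚ) : ℝ) := by
  have hT := c.twInv_table D hD
  obtain ⟨l1, l2, _, _⟩ := hT.len
  have h1 : c.cnt n ≤ (c.tableRe D).1.length := by rw [tableRe, l1]; exact hK
  have h2 : c.cnt n ≤ (c.tableRe D).2.length := by rw [tableRe, l2]; exact hK
  rw [c.UqT_eq D _ n h1 h2 hK hD hq]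
  push_cast
  refine sum_congr rfl fun i hi => ?_
  rw [mem_range] at hi
  have hre := hT.re i (by omega)
  rw [tableRe, hre]
  have hch : (((2 * i + (n - 1)).choose (n - 1) : ℕ) : ℝ)
      = ((2 * i + (n - 1))! : ℝ) / (((2 * i)! : ℝ) * ((n - 1)! : ℝ)) := by
    rw [eq_div_iff (by positivity), ← mul_assoc]
    exact_mod_cast Nat.add_choose_mul_factorial_mul_factorial (2 * i) (n - 1)
  rw [hch, show (n - 1) + 2 * i = 2 * i + (n - 1) by ring]
  have hf1 : (((2 * i))! : ℝ) ≠ 0 := by positivity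
  have hf2 : (((n - 1))! : ℝ) ≠ 0 := by positivity
  have hf3 : ((c.Mh)! : ℝ) ≠ 0 := by positivity
  have hD0 : (((2 * D : ℕ) : ℝ)) ^ (2 * i) ≠ 0 := by positivity
  have hq' : (c.qden : ℝ) ^ D ≠ 0 := by positivity
  field_simp

end TwCert


/-! ### Part 5a: the size of the coefficients `‖N!·[s^N] G^D‖ ≤ q^D (2D)^N` by a majorant series -/

/-- **At most `2^N` walks of length `N`** end in any finite set of sites. [cite: FitznerVanDerHofstad2016NoBLE, §5.1.1 (5.4)–(5.5) pp. 1089–1090] -/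
theorem sum_walk1_le_two_pow : ∀ (N : ℕ) (S : Finset ℤ), ∑ a ∈ S, SrwCount.walk1 N a ≤ 2 ^ N
  | 0, S => by
      simp only [SrwCount.walk1_zero, pow_zero, Finset.sum_ite_eq', ]
      split_ifs <;> simp
  | N + 1, S => by
      simp only [SrwCount.walk1_succ, sum_add_distrib, pow_succ]
      have h1 := sum_walk1_le_two_pow N (S.map (Equiv.subRight (1 : ℤ)).toEmbedding)
      have h2 := sum_walk1_le_two_pow N (S.map (Equiv.subRight (-1 : ℤ)).toEmbedding)
      rw [Finset.sum_map] at h1 h2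
      simp only [Equiv.coe_toEmbedding, Equiv.subRight_apply, sub_neg_eq_add] at h1 h2
      omega

/-- **The folded order row counts at most `2^N` walks** (`m > 0`: the orders `0, ±m, …, ±Jm` are
distinct sites). [cite: FitznerVanDerHofstad2016NoBLE, §5.1.1 (5.4)–(5.5) pp. 1089–1090] -/
theorem sum_eps_walk1_le_two_pow (N m J : ℕ) (hm : 0 < m) :
    ∑ j ∈ range (J + 1), epsN j * SrwCount.walk1 N ((j * m : ℕ) : ℤ) ≤ 2 ^ N := by
  have hm' : (m : ℤ) ≠ 0 := by exact_mod_cast hm.ne'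
  have hfold := sum_Icc_neg_eq_sum_range_eps (fun j : ℤ => (SrwCount.walk1 N (j * m) : ℂ))
    (fun j => by rw [neg_mul, SrwCount.walk1_neg]) J
  rw [← sum_image_mul_int hm' (Finset.Icc (-(J : ℤ)) J) (fun a => (SrwCount.walk1 N a : ℂ))] at hfold
  have hle := sum_walk1_le_two_pow N ((Finset.Icc (-(J : ℤ)) J).image (fun j : ℤ => j * m))
  have hcast : ((∑ j ∈ range (J + 1), epsN j * SrwCount.walk1 N ((j * m : ℕ) : ℤ) : ℕ) : ℂ)
      = ((∑ a ∈ (Finset.Icc (-(J : ℤ)) J).image (fun j : ℤ => j * m), SrwCount.walk1 N a : ℕ) : ℂ) := by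
    push_cast
    rw [hfold]
    refine sum_congr rfl fun j _ => ?_
    by_cases hj0 : j = 0 <;> simp [epsN, hj0]
  have := (Nat.cast_injective (R := ℂ)) hcast
  omega

/-- **Size of the row numerators**: `‖φ(N)‖ ≤ q · 2^N` when `|Q_j| ≤ q` (`j ≤ J`) and `m > 0`. [cite: FitznerVanDerHofstad2016NoBLE, §5.1.1 (5.4)–(5.5) pp. 1089–1090] -/
theorem norm_twRowC_le (m J : ℕ) (Q : ℕ → ℤ) (q : ℕ) (hm : 0 < m)
    (hQ : ∀ j, j ≤ J → (Q j).natAbs ≤ q) (N : ℕ) :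
    ‖twRowC m J Q N‖ ≤ (q : ℝ) * 2 ^ N := by
  unfold twRowC
  refine (norm_sum_le _ _).trans ?_
  have hterm : ∀ j ∈ range (J + 1), ‖(epsN j : ℂ) * Complex.I ^ j * (Q j : ℂ)
      * (SrwCount.walk1 N ((j * m : ℕ) : ℤ) : ℂ)‖
      ≤ (q : ℝ) * ((epsN j * SrwCount.walk1 N ((j * m : ℕ) : ℤ) : ℕ) : ℝ) := by
    intro j hj
    rw [mem_range] at hj
    rw [norm_mul, norm_mul, norm_mul, norm_pow, Complex.norm_I, one_pow, mul_one,
      Complex.norm_natCast, Complex.norm_natCast, Complex.norm_intCast]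
    have hq : |(Q j : ℝ)| ≤ (q : ℝ) := by
      rw [← Int.cast_abs]
      have := hQ j (by omega)
      have h' : |Q j| ≤ (q : ℤ) := by rw [Int.abs_eq_natAbs]; exact_mod_cast this
      exact_mod_cast h'
    rw [Nat.cast_mul (epsN j)]
    calc (epsN j : ℝ) * |(Q j : ℝ)| * (SrwCount.walk1 N ((j * m : ℕ) : ℤ) : ℝ)
        = |(Q j : ℝ)| * ((epsN j : ℝ) * (SrwCount.walk1 N ((j * m : ℕ) : ℤ) : ℝ)) := by ring
      _ ≤ (q : ℝ) * ((epsN j : ℝ) * (SrwCount.walk1 N ((j * m : ℕ) : ℤ) : ℝ)) :=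
          mul_le_mul_of_nonneg_right hq (by positivity)
  refine (sum_le_sum hterm).trans ?_
  rw [← mul_sum, ← Nat.cast_sum]
  have h2 := sum_eps_walk1_le_two_pow N m J hm
  have : ((∑ j ∈ range (J + 1), epsN j * SrwCount.walk1 N ((j * m : ℕ) : ℤ) : ℕ) : ℝ) ≤ 2 ^ N := by
    exact_mod_cast h2
  exact mul_le_mul_of_nonneg_left this (Nat.cast_nonneg q)

/-- Coefficientwise domination of a complex formal series by a real one. [cite: FitznerVanDerHofstad2016NoBLE, §5.1.1 (5.4)–(5.5) pp. 1089–1090] -/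
def MajC (G : PowerSeries ℂ) (H : PowerSeries ℝ) : Prop :=
  ∀ N, ‖PowerSeries.coeff N G‖ ≤ PowerSeries.coeff N H

/-- A dominating series has nonnegative coefficients. [cite: FitznerVanDerHofstad2016NoBLE, §5.1.1 (5.4)–(5.5) pp. 1089–1090] -/
theorem MajC.nonneg {G : PowerSeries ℂ} {H : PowerSeries ℝ} (h : MajC G H) (N : ℕ) :
    0 ≤ PowerSeries.coeff N H := (norm_nonneg _).trans (h N)

/-- Domination is preserved by products. [cite: FitznerVanDerHofstad2016NoBLE, §5.1.1 (5.4)–(5.5) pp. 1089–1090] -/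
theorem majC_mul {G G' : PowerSeries ℂ} {H H' : PowerSeries ℝ} (h : MajC G H) (h' : MajC G' H') :
    MajC (G * G') (H * H') := by
  intro N
  rw [PowerSeries.coeff_mul, PowerSeries.coeff_mul]
  refine (norm_sum_le _ _).trans (sum_le_sum fun x _ => ?_)
  rw [norm_mul]
  exact mul_le_mul (h x.1) (h' x.2) (norm_nonneg _) (h.nonneg x.1)

/-- Domination is preserved by powers. [cite: FitznerVanDerHofstad2016NoBLE, §5.1.1 (5.4)–(5.5) pp. 1089–1090] -/
theorem majC_pow {G : PowerSeries ℂ} {H : PowerSeries ℝ} (h : MajC G H) : ∀ p : ℕ, MajC (G ^ p) (H ^ p)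
  | 0 => by
      intro N
      rw [pow_zero, pow_zero, PowerSeries.coeff_one, PowerSeries.coeff_one]
      split_ifs <;> simp
  | p + 1 => by
      rw [pow_succ, pow_succ]
      exact majC_mul (majC_pow h p) h

/-- The exponential majorant `q·e^{as}`: coefficients `q a^N/N!`. [cite: FitznerVanDerHofstad2016NoBLE, §5.1.1 (5.4)–(5.5) pp. 1089–1090] -/
noncomputable def expMaj (q a : ℝ) : PowerSeries ℝ := q • PowerSeries.rescale a (PowerSeries.exp ℝ)

/-- Coefficients of `expMaj`. [cite: FitznerVanDerHofstad2016NoBLE, §5.1.1 (5.4)–(5.5) pp. 1089–1090] -/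
theorem coeff_expMaj (q a : ℝ) (N : ℕ) :
    PowerSeries.coeff N (expMaj q a) = q * a ^ N / (N ! : ℝ) := by
  rw [expMaj, map_smul, PowerSeries.coeff_rescale, PowerSeries.coeff_exp, smul_eq_mul]
  simp
  field_simp

/-- Powers of `e^{as}`: `(e^{as})^{p+1} = e^{(p+1)as}`. [cite: FitznerVanDerHofstad2016NoBLE, §5.1.1 (5.4)–(5.5) pp. 1089–1090] -/
theorem rescale_exp_pow (a : ℝ) : ∀ p : ℕ,
    (PowerSeries.rescale a (PowerSeries.exp ℝ)) ^ (p + 1)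
      = PowerSeries.rescale (((p + 1 : ℕ) : ℝ) * a) (PowerSeries.exp ℝ)
  | 0 => by simp
  | p + 1 => by
      rw [pow_succ, rescale_exp_pow a p, PowerSeries.exp_mul_exp_eq_exp_add]
      congr 1; push_cast; ring

/-- Coefficients of `expMaj q a ^ D` (`D ≥ 1`): `q^D (Da)^N / N!`. [cite: FitznerVanDerHofstad2016NoBLE, §5.1.1 (5.4)–(5.5) pp. 1089–1090] -/
theorem coeff_expMaj_pow (q a : ℝ) (D N : ℕ) (hD : 1 ≤ D) :
    PowerSeries.coeff N (expMaj q a ^ D) = q ^ D * ((D : ℝ) * a) ^ N / (N ! : ℝ) := by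
  obtain ⟨p, rfl⟩ : ∃ p, D = p + 1 := ⟨D - 1, by omega⟩
  rw [expMaj, _root_.smul_pow, rescale_exp_pow, map_smul, PowerSeries.coeff_rescale,
    PowerSeries.coeff_exp, smul_eq_mul]
  simp
  field_simp

/-- **The twisted row is dominated by `q·e^{2s}`** (`|Q_j| ≤ q`, `m > 0`). [cite: FitznerVanDerHofstad2016NoBLE, §5.1.1 (5.4)–(5.5) pp. 1089–1090] -/
theorem majC_twG (m J : ℕ) (Q : ℕ → ℤ) (q : ℕ) (hm : 0 < m) (hQ : ∀ j, j ≤ J → (Q j).natAbs ≤ q) :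
    MajC (twG m J Q) (expMaj (q : ℝ) 2) := by
  intro N
  rw [coeff_twG, coeff_expMaj, norm_div, Complex.norm_natCast, div_le_div_iff_of_pos_right (by positivity)]
  exact norm_twRowC_le m J Q q hm hQ N

/-- **Size of the power-table coefficients**: `‖N!·[s^N] G^D‖ ≤ q^D (2D)^N` (`D ≥ 1`, `|Q_j| ≤ q`, `m > 0`).
[cite: FitznerVanDerHofstad2016NoBLE, §5.1.1 (5.4)–(5.5) pp. 1089–1090] -/
theorem norm_coeff_twG_pow_le (m J : ℕ) (Q : ℕ → ℤ) (q : ℕ) (hm : 0 < m)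
    (hQ : ∀ j, j ≤ J → (Q j).natAbs ≤ q) (D : ℕ) (hD : 1 ≤ D) (N : ℕ) :
    (N ! : ℝ) * ‖PowerSeries.coeff N (twG m J Q ^ D)‖ ≤ (q : ℝ) ^ D * (2 * D : ℝ) ^ N := by
  have h := majC_pow (majC_twG m J Q q hm hQ) D N
  rw [coeff_expMaj_pow _ _ _ _ hD] at h
  have hN : (0 : ℝ) < (N ! : ℝ) := by positivity
  calc (N ! : ℝ) * ‖PowerSeries.coeff N (twG m J Q ^ D)‖
      ≤ (N ! : ℝ) * ((q : ℝ) ^ D * ((D : ℝ) * 2) ^ N / (N ! : ℝ)) := mul_le_mul_of_nonneg_left h hN.le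
    _ = (q : ℝ) ^ D * (2 * D : ℝ) ^ N := by
          rw [mul_div_assoc', mul_div_cancel_left₀ _ hN.ne', mul_comm (D : ℝ) 2]


/-! ### Part 5b: the coefficients of `G^D` sum to `Φ(s)^D`, `Φ(s) = Σ_{j≤J} ε_j i^j Q_j I_{jm}(2s)` -/

section Analytic

open Literature.Probability.LatticeModels (besselI)

/-- **The analytic row** `Φ(s) = Σ_{j ≤ J} ε_j i^j Q_j I_{jm}(2s)`. [cite: FitznerVanDerHofstad2016NoBLE, §5.1.1 (5.4)–(5.5) pp. 1089–1090] -/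
noncomputable def twRowFun (m J : ℕ) (Q : ℕ → ℤ) (s : ℝ) : ℂ :=
  ∑ j ∈ range (J + 1), (epsN j : ℂ) * Complex.I ^ j * (Q j : ℂ)
    * (besselI ((j * m : ℕ) : ℤ) (2 * s) : ℂ)

/-- **The formal row sums to the analytic row**: `Σ_N [s^N]G · s^N = Φ(s)` (Bessel EGF
`Σ_N walk1(N,a) s^N/N! = I_a(2s)`). [cite: FitznerVanDerHofstad2016NoBLE, §5.1.1 (5.4)–(5.5) pp. 1089–1090] -/
theorem hasSum_coeff_twG (m J : ℕ) (Q : ℕ → ℤ) (s : ℝ) :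
    HasSum (fun N => PowerSeries.coeff N (twG m J Q) * (s : ℂ) ^ N) (twRowFun m J Q s) := by
  have hj : ∀ j : ℕ, HasSum (fun N : ℕ => (epsN j : ℂ) * Complex.I ^ j * (Q j : ℂ)
      * ((SrwCount.walk1 N ((j * m : ℕ) : ℤ) : ℂ) * (s : ℂ) ^ N / (N ! : ℂ)))
      ((epsN j : ℂ) * Complex.I ^ j * (Q j : ℂ) * (besselI ((j * m : ℕ) : ℤ) (2 * s) : ℂ)) := by
    intro j
    have h := Complex.ofRealCLM.hasSum (SrwCount.hasSum_walk1_egf ((j * m : ℕ) : ℤ) s)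
    simp only [Complex.ofRealCLM_apply] at h
    push_cast at h
    exact h.mul_left _
  have hsum := hasSum_sum (s := range (J + 1)) (fun j _ => hj j)
  refine hsum.congr_fun fun N => ?_
  rw [coeff_twG, twRowC, sum_div, sum_mul]
  refine sum_congr rfl fun j _ => ?_
  ring

/-- The terms `[s^N]G^p · s^N` are absolutely summable (`p ≥ 1`; majorant `q^p e^{2p|s|}`). [cite: FitznerVanDerHofstad2016NoBLE, §5.1.1 (5.4)–(5.5) pp. 1089–1090] -/
theorem summable_norm_coeff_twG_pow (m J : ℕ) (Q : ℕ → ℤ) (q : ℕ) (hm : 0 < m)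
    (hQ : ∀ j, j ≤ J → (Q j).natAbs ≤ q) (p : ℕ) (hp : 1 ≤ p) (s : ℝ) :
    Summable (fun N => ‖PowerSeries.coeff N (twG m J Q ^ p) * (s : ℂ) ^ N‖) := by
  have hmaj := majC_pow (majC_twG m J Q q hm hQ) p
  refine Summable.of_nonneg_of_le (fun N => norm_nonneg _) (fun N => ?_)
    ((Real.summable_pow_div_factorial ((p : ℝ) * 2 * |s|)).mul_left ((q : ℝ) ^ p))
  rw [norm_mul, norm_pow, Complex.norm_real, Real.norm_eq_abs]
  have h := hmaj N
  rw [coeff_expMaj_pow _ _ _ _ hp] at h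
  calc ‖PowerSeries.coeff N (twG m J Q ^ p)‖ * |s| ^ N
      ≤ ((q : ℝ) ^ p * ((p : ℝ) * 2) ^ N / (N ! : ℝ)) * |s| ^ N :=
        mul_le_mul_of_nonneg_right h (by positivity)
    _ = (q : ℝ) ^ p * (((p : ℝ) * 2 * |s|) ^ N / (N ! : ℝ)) := by rw [mul_pow _ |s|]; ring

/-- **The formal power table sums to the analytic power**: `Σ_N [s^N]G^p · s^N = Φ(s)^p` (`p ≥ 1`,
Cauchy products of absolutely summable series). [cite: FitznerVanDerHofstad2016NoBLE, §5.1.1 (5.4)–(5.5) pp. 1089–1090] -/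
theorem hasSum_coeff_twG_pow (m J : ℕ) (Q : ℕ → ℤ) (q : ℕ) (hm : 0 < m)
    (hQ : ∀ j, j ≤ J → (Q j).natAbs ≤ q) (s : ℝ) : ∀ p : ℕ, 1 ≤ p →
    HasSum (fun N => PowerSeries.coeff N (twG m J Q ^ p) * (s : ℂ) ^ N) (twRowFun m J Q s ^ p)
  | 0, h => absurd h (by omega)
  | 1, _ => by simpa only [pow_one] using hasSum_coeff_twG m J Q s
  | p + 2, _ => by
      have ih := hasSum_coeff_twG_pow m J Q q hm hQ s (p + 1) (by omega)
      have h1 := hasSum_coeff_twG m J Q s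
      have hf := summable_norm_coeff_twG_pow m J Q q hm hQ (p + 1) (by omega) s
      have hg := summable_norm_coeff_twG_pow m J Q q hm hQ 1 le_rfl s
      simp only [pow_one] at hg
      have hprod := tsum_mul_tsum_eq_tsum_sum_antidiagonal_of_summable_norm hf hg
      rw [ih.tsum_eq, h1.tsum_eq] at hprod
      have hhs := (summable_norm_sum_mul_antidiagonal_of_summable_norm hf hg).of_norm.hasSum
      rw [← hprod] at hhs
      rw [pow_succ]
      refine hhs.congr_fun fun N => ?_
      rw [pow_succ, PowerSeries.coeff_mul, sum_mul]
      refine sum_congr rfl fun kl hkl => ?_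
      rw [Finset.mem_antidiagonal] at hkl
      rw [← hkl, pow_add]
      ring

end Analytic

end Literature.Probability.FitznerVanDerHofstad2017.SeedCert
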